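import Literature.Claims.NS.Kyritsis2021
import Literature.Analysis.FluidPDE.NSVorticityBKMHolds
import Literature.Claims.NS.ClayPeriodicSerrinBridge
import Literature.Claims.NS.ClayPeriodicPressureBridge
import Literature.Analysis.FluidPDE.TsaiTopSingularNullHolds
import Literature.MeasureTheory.Hausdorff.EuclideanHausdorffComparison
import HarnessLib

/-!
# Claim skeleton: Kyritsis (2026), «Under the hypotheses of the initial conditions of the Millennium
# problem about the Navier–Stokes equations, there cannot be shaped in finite time, any velocities
# blow-ups to infinite (singularities)» — arXiv:1902.07265v23, Chapter 7 (K-V)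

Cell `ns-claims` (D-0090 NS-CLAIMS SWEEP), claim C03d, typist `ns-claims-typist-3`.
UNREFEREED/DISPUTED CLAIM under adjudication — NOTHING in this file asserts a step: every `Step_k`
is a `Prop` (the paper's k-th load-bearing assertion, typed concretely so that `¬ Step_k` or its
vacuity can be a kernel theorem, to be filed by a refuter summit-side as
`Theorems/SoloRefuteKyritsis2026.lean`); the only `theorem`s are kernel COMPOSITIONS of the paper's
own implications and unfolding lemmas.

Version of record (lead ruling 2026-08-26T17:35:52Z; pinned by ns-claims-lit-3): K. E. Kyritsis,
*The solutions of the 3rd and 4th Clay Millennium problems*, arXiv:1902.07265 **v23** [math.GM]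
(6 Apr 2026, 99 pp., PDF only), Chapter 7, pp. 85–99 [Kyritsis2026]; locators are v23 PDF pages;
materialised `pub/ns-claims/sources/Kyritsis2026/arXiv-1902.07265v23-Ch7-pp85-99-text_PINNED/`
(displayed equations reconstructed in `p00NN_forms.txt`), `LOCATORS.md` there. The chapter first
appears in v22 (30 Mar 2026) and is the author's FIFTH regularity argument (CKN singular points and
«1D integrals of the pressure forces»); C03 (`Kyritsis2022.lean`, circulation), C03b
(`Kyritsis2021.lean`, pressures via virtual work; its vocabulary `IsLocalClassSolution`,
`IsGlobalClassSolution` is re-used here by import) and C03c (2017, conservation of particles) are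
distinct arguments.

## Claimed statement (as printed)

THEOREM 3.4, p. 94 («THE CRUCIAL THEOREM FOR THE SOLUTION»): «There cannot be created any finite
point S of blow-up of velocities, within a finite time interval, after the standard hypotheses of
the formulation of the 4th Millennium problem about the Navier-Stokes equations, as this would lead
that it must be necessarily a singularity and blow-up on an open 3D region of S too!»; §4, p. 97:
«(THEOREM A) Existence and smoothness of Navier-Stokes solution on R³ … (2.1), (2.2), (2.3), (2.6),
(2.7)» and «(THEOREM B) … on R³/Z³ … (2.1), (2.2), (2.3), (2.10), (2.11)» with (2.10) = «u(x+eⱼ,t) =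
u(x,t), p(x+eⱼ,t) = p(x,t)» (p. 88), i.e. Clay (A) and the CMI-errata reading of (B), asserted
«under the Fefferman implicit hypothesis … and if the CKN theory is valid» (p. 97). Typed:
`ClaimedTheorem := clayR3.Regularity ∧ clayPeriodicErrata.Regularity`; Theorem 3.4 is `Step_6`.

## Clay delta (reference `ClayVariants.lean`)

Nearest: (A) — `ClaimedTheorem → clayR3.Regularity` is `And.left` (`clay_of_claimed`). Axes: domain
ℝ³ and ℤ³-periodic = · force ≡ 0 = · data (2.4) = (4) = · solution class C^∞ + (2.7) = · horizon
[0,∞) = · pressure: (2.10) includes `p` periodic (errata form ⇒ printed (B), `clayB_of_claimed`) ·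
viscosity ∀ ν > 0 =. The provisos «if the CKN theory is valid» (Caffarelli–Kohn–Nirenberg 1982 is a
theorem in print) and «Fefferman implicit hypothesis» (loss of smoothness forces `sup|u| → ∞`,
printed in the Clay text, p. 2) are not deltas. Not a «wrong problem» candidate.

## Steps (paper item · v23 page · typist's private flag)

* `Step_1`  Lemma 2.1 / Thm 2.1 (pp. 89–90; Majda–Bertozzi Thm 3.4, Cor. 3.2): the whole-space local
  theory package for `ν > 0` and a Clay datum — global solution in the class with bounded energy
  (2.7), OR a solution in the class on `[0,T*)`, `T* < ∞`, admitting no continuation — plausible (known).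
* `Step_2`  Thm 2.2 (pp. 90–91, BKM) — IS the tree fact
  `Literature.Analysis.FluidPDE.lintegral_iSup_curl_eq_top_of_not_hasSobolevExtensionPast`
  (discharged in the tree); recalled by the paper, consumed by no typed implication — true.
* `Step_3`  «Fefferman implicit hypothesis of velocities blow-up» (pp. 96–97) with Lemma 3.2 (p. 91,
  Galdi: «impossible … a singularity of the velocities at the spatial infinite»): a finite maximal
  time produces a FINITE velocity blow-up point `S` — plausible (known via the `L^∞` blow-up rate and
  CKN ε-regularity + decay; non-trivial).
* `Step_4`  Lemma 3.1 (p. 91, «from the CKN theory»): the velocity blow-up points at time `T*` form a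
  Lebesgue-null set containing no ball — plausible (known for suitable weak solutions); support of
  Theorem 3.4's second contradiction only.
* `Step_5`  Lemma 3.3 (pp. 92–94), «1D integrals of pressure forces will blow-up in a finite time
  velocities blow-up»: at a time `T* − δt` BEFORE the blow-up, the work of the pressure force
  `F_p = −∇p` along paths from any fixed `A` to `B` diverges as `B → S` — suspicious (at a fixed
  pre-blow-up time `p(·, T*−δt)` is `C^∞`, so the work along the segment is `p(A) − p(B)`, bounded
  near `S`; the displayed support (3.4.0)–(3.4.4), p. 93, evaluates CKN's blow-up RATE — a bound along
  the approach to `(S,T*)` — as pointwise bounds `|p| ≥ C₂/r²`, `|F_p| ≥ C₃/r³` at the earlier time).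
  THE KERNEL FACT `step6_of_step5` BELOW shows that Lemma 3.3, as typed, already IS Theorem 3.4: its
  conclusion is never instantiated, so it holds exactly when there is no blow-up point (vacuity).
* `Step_6`  Theorem 3.4 (pp. 94–95, statement): no classical solution on `[0,T)` has a finite
  velocity blow-up point at `T` — open-strength (with `Step_1`, `Step_3` it is Clay (A)); its printed
  proof ((3.4.5)–(3.4.10): «∫_{B(S,R)} F_p dV = +∞» by Lemma 3.3 versus the divergence theorem
  `∫_B ∇p = ∮ p n dS`) is replaced in the kernel by the gradient theorem (`step6_of_step5`).
* `Step_7`  the periodic package behind «(THEOREM B)» (Remarks 2.5–2.6 pp. 90–91 «obviously this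
  proposition covers the periodic case too»; Lemma 3.2, p. 91: «we may as well formulate the proof for
  the periodic case, which has compact fundamental region»): for `ν > 0` and a smooth periodic datum,
  a global classical solution with `u`, `p` periodic, OR a classical periodic solution on some
  `[0,T*)`, `T* < ∞`, with a velocity blow-up point — plausible (known: torus local theory, `L^∞`
  blow-up criterion, compactness of the fundamental domain) — PROVED in-file, `step_7_holds` (revision:
  the tree's periodic blow-up alternative `not_clayPeriodic_solvable_iff_exists_velocitySupBlowup`, the
  pressure renormalisation `clayPeriodic_solvable_zero_iff_errata`, and Bolzano–Weierstrass on the cell).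
Ordered index (TYPING-HYGIENE 11): Step 1 = `Step_1` (Lemma 2.1/Thm 2.1, pp. 89–90) · Step 2 =
`Step_2` (Thm 2.2, pp. 90–91) · Step 3 = `Step_3` (Lemma 3.2 p. 91 + pp. 96–97) · Step 4 = `Step_4`
(Lemma 3.1, p. 91) · Step 5 = `Step_5` (Lemma 3.3, pp. 92–94) · Step 6 = `Step_6` (Thm 3.4, pp. 94–95)
· Step 7 = `Step_7` (Remarks 2.5–2.6, Lemma 3.2, Theorem B, pp. 90–91, 97) · Step 8 = `Step_8` (eqs.
(3.4.0)–(3.4.2), p. 93 — the displayed support of Lemma 3.3, logically between Steps 4 and 5;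
appended in revision 2) · Step 9 = `Step_9` (eq. (3.4.9), p. 95 — inside the proof of Theorem 3.4,
logically between Steps 5 and 6; appended in revision 2) · print-class forms `Step5C`, `Step6C`,
`Step8C`, `Step9C` (same locators, class `InPrintClass`; appended in revision 3).
* `Step_8`  eqs. (3.4.0)–(3.4.2) (p. 93): at time `T* − δt`, a.e. on a small ball around `S`,
  `‖u‖ ≥ C/R` with `R² = ‖x−S‖² + δt²` (the CKN rate read pointwise), `|p| ≥ C₂/r²`, `‖F_p‖ ≥ C₃/r³`
  (`r = ‖x−S‖`) — suspicious ((3.4.0) is attributed to CKN p. 795, which bounds a scale-invariant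
  quantity along the approach to `(S,T*)`; (3.4.1)–(3.4.2) contradict the continuity of `p(·,T*−δt)`
  at `S` whenever instantiated: `step6_of_step8`).
* `Step_9`  eq. (3.4.9) (p. 95): at time `T* − δt` «the 3D integral of the pressure forces over
  B(S,R) … = +∞», in the WORK reading fixed by the author's (3.4.10) («(∇,pu) = (u,∇p) + p(∇,u) … =
  ∮ p (u,n) dA», «represents total work of them»), typed junk-value-safe as `∫⁻_{B̄(S,R)} |F_p · u| = ⊤`
  — suspicious (at a fixed pre-blow-up time the integrand is continuous on the compact ball:
  `workIntegral_lt_top`, the kernel form of the finiteness the print itself asserts at (3.4.10);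
  hence `step6_of_step9`).

## COMPOSITION — proved as `claim_of_steps`

* `step6_of_step5 : Step_5 → Step_6` — PROVED (by the gradient theorem `pressureForceWork_eq`: at
  the pre-blow-up time of Lemma 3.3 the pressure slice is smooth, the work along the segment from `S`
  to `B` tends to `0` as `B → S`, so the divergence asserted by Lemma 3.3 is impossible and no
  blow-up point can exist; the paper's own route through (3.4.5)–(3.4.10) is not typed). Converse
  `step5_of_step6` — PROVED (no blow-up point ⇒ Lemma 3.3 holds vacuously); hence
  `step5_iff_step6 : Step_5 ↔ Step_6`: Lemma 3.3 carries exactly the content of Theorem 3.4.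
* `claim_of_steps : Step_1 → … → Step_7 → ClaimedTheorem` — PROVED; consumes Steps 1, 3, 5 (→ 6), 7
  (§4, pp. 95–97: every finite-time loss of smoothness produces a finite velocity blow-up point
  (Step 3 / Step 7), which Theorem 3.4 forbids; (2.7) from the energy clause of Step 1). `Step_2`,
  `Step_4` are recalled results consumed by no typed implication.
* Revision 2 (append-only, referee lane 1 pre-verdict advice `claims/Kyritsis2026/RETYPE.md` v0):
  `workIntegral_lt_top` ((3.4.10)'s finiteness at every pre-blow-up time — PROVED);
  `step6_of_step9 : Step_9 → Step_6` (Theorem 3.4's printed reductio (3.4.9) vs (3.4.10) — PROVED),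
  `step9_of_step6` (vacuous converse), `step9_iff_step6`; `step6_of_step8 : Step_8 → Step_6`
  ((3.4.1) is never instantiated — PROVED), `step8_of_step6`, `step8_iff_step6`;
  `claim_of_all_steps : Step_1 → … → Step_9 → ClaimedTheorem` — PROVED (via `claim_of_steps`).
  Kernel record: Steps 5, 8, 9 are each EQUIVALENT to Theorem 3.4 (`Step_6`) — the displayed chain
  (3.4.0) → (3.4.4) → (3.4.9) consists of statements that hold only when there is no blow-up point.
* Revision 3 (append-only; referee lane 1 F3 flag 18:42:09Z, lead rulings 18:46:28Z / 19:09:27Z):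
  Steps 5, 6, 8, 9 above quantify over ALL classical unforced solutions on `ℝ³ × [0,T)`, wider than
  the print's «after the standard hypotheses of the formulation of the 4th Millennium problem»
  (p. 94) — the wide class admits parasitic infinite-energy witnesses (`u = e₁/(T−t)`,
  `p = −x₁/(T−t)²`) that are typing artefacts, not verdicts. The PRINT-FAITHFUL class-restricted
  forms `Step5C`, `Step6C`, `Step8C`, `Step9C` (solutions in the paper's (A)-class
  `IsLocalClassSolution` OR classical ℤ³-periodic, `InPrintClass`) are appended with
  `stepKC_of_stepK`, the equivalences `step5C_iff_step6C`, `step8C_iff_step6C`, `step9C_iff_step6C`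
  (the circularity is NOT an artefact of the wide class) and `claim_of_stepsC : Step_1 → Step_3 →
  Step5C → Step_7 → ClaimedTheorem` — PROVED (decls of `InPrintClass`/`Step5C`/`Step6C` and their
  glue verbatim from ns-claims-ref-1's `retype-Kyritsis2026.lean`). Verdict-of-record locator
  (lead 19:09:27Z): `Step8C` ((3.4.0)–(3.4.2) p. 93; load-bearing Lemma 3.3 = `Step5C`), class
  vacuous, by `step8C_iff_step6C`.

WHAT THIS IS NOT: not a claim about NS regularity or blow-up; not a claim about any author beyond the
typed locator.
-/

open MeasureTheory Set Filter
open scoped ContDiff ENNReal Topology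

namespace Literature.Claims.NS.Kyritsis2026

open Literature.Analysis.FluidPDE
open Literature.Claims.NS.Kyritsis2021 (IsLocalClassSolution IsGlobalClassSolution)

noncomputable section

/-! ## Vocabulary (definitions with bodies; nothing asserted) -/

/-- «A point S of velocity blow-up, created in finite time T*» (Lemma 3.3, p. 92; Thm 3.4, p. 94;
§3 title «finite time blow-ups / singularities … as in the CKN theory»): the velocity of the solution
on `[0,T)` is unbounded in every parabolic neighbourhood `B(S,r) × (T−r, T)` of `(S,T)`.
[cite: Kyritsis2026, Lemma 3.3 p. 92 and Theorem 3.4 p. 94] -/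
def IsVelocityBlowupPoint (u : ℝ → EuclideanSpace ℝ (Fin 3) → EuclideanSpace ℝ (Fin 3)) (T : ℝ)
    (S : EuclideanSpace ℝ (Fin 3)) : Prop :=
  ∀ M r : ℝ, 0 < r → ∃ t ∈ Ico 0 T, ∃ x : EuclideanSpace ℝ (Fin 3),
    dist x S < r ∧ T - r < t ∧ M < ‖u t x‖

/-- The «1D integral of the pressure forces» `F_p = −∇q` of a pressure slice `q = p(·,t)` along the
straight path from `A` to `B` (Lemma 3.3, p. 92: «any path P = AB from a fixed … point A, till a
point B»; the work `∫_P F_p · ds` of the conservative field `F_p`, cf. eq. (3.4.4) p. 94):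
`−∫₀¹ Dq(A + s(B − A))[B − A] ds`. Junk value `0` of `fderiv` where `q` is not differentiable.
[cite: Kyritsis2026, Lemma 3.3, pp. 92–94] -/
def pressureForceWork (q : EuclideanSpace ℝ (Fin 3) → ℝ) (A B : EuclideanSpace ℝ (Fin 3)) : ℝ :=
  -∫ s in (0 : ℝ)..1, fderiv ℝ q (A + s • (B - A)) (B - A)

/-- **Gradient theorem along a segment**: for a `C¹` pressure slice the work of `F_p = −∇q` from `A`
to `B` is `q(A) − q(B)` — the author's own eqs. (24)–(25) of the 2021 text: «it is known by the
gradient theorem, that this work equals, the difference of the potential at these points, and here,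
it is the pressures» (elementary calculus: chain rule and the fundamental theorem of calculus along
the straight path). [cite: Kyritsis2021b, eqs. (24)–(25), p. 16] -/
theorem pressureForceWork_eq {q : EuclideanSpace ℝ (Fin 3) → ℝ} (hq : ContDiff ℝ 1 q)
    (A B : EuclideanSpace ℝ (Fin 3)) : pressureForceWork q A B = q A - q B := by
  unfold pressureForceWork
  -- the straight path and its derivative
  have hγ : ∀ s : ℝ, HasDerivAt (fun s : ℝ => A + s • (B - A)) (B - A) s := fun s => by
    simpa using ((hasDerivAt_id s).smul_const (B - A)).const_add A
  have hq1 : Differentiable ℝ q := hq.differentiable one_ne_zero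
  have hcomp : ∀ s : ℝ, HasDerivAt (fun s : ℝ => q (A + s • (B - A)))
      (fderiv ℝ q (A + s • (B - A)) (B - A)) s := fun s =>
    ((hq1 _).hasFDerivAt.comp_hasDerivAt s (hγ s))
  have hcont : Continuous fun s : ℝ => fderiv ℝ q (A + s • (B - A)) (B - A) :=
    ((hq.continuous_fderiv one_ne_zero).comp (continuous_const.add
      (continuous_id.smul continuous_const))).clm_apply continuous_const
  rw [intervalIntegral.integral_eq_sub_of_hasDerivAt (fun s _ => hcomp s)
    (hcont.intervalIntegrable 0 1)]
  simp

/-! ## The claimed statement -/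

/-- **«(THEOREM A)» and «(THEOREM B)», §4 p. 97, as printed**: Clay (A) and Clay (B) in the
CMI-errata reading ((2.10), p. 88, asks `u` AND `p` periodic), over the schema of `ClayVariants.lean`
(`clayR3.Regularity` is token-for-token the summit statement (A)).
[cite: Kyritsis2026, §4 (THEOREM A) (THEOREM B), p. 97] -/
def ClaimedTheorem : Prop :=
  ClayVariants.clayR3.Regularity ∧ ClayVariants.clayPeriodicErrata.Regularity

/-- The claimed theorem implies Clay (A) (first conjunct). [cite: Kyritsis2026, §4 (THEOREM A), p. 97] -/
theorem clay_of_claimed (h : ClaimedTheorem) : ClayVariants.clayR3.Regularity :=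
  h.1

/-- The claimed (THEOREM B) is the errata reading, which implies the printed Clay (B) leaf.
[cite: Kyritsis2026, §4 (THEOREM B), p. 97] -/
theorem clayB_of_claimed (h : ClaimedTheorem) : ClayVariants.clayPeriodic.Regularity :=
  ClayVariants.clayPeriodic_regularity_iff.mpr
    (ClayVariants.clayPeriodicErrata_regularity_imp_printed h.2)

/-! ## The steps -/

/-- **Step 1 — Lemma 2.1 (p. 90) with Theorem 2.1 (p. 90; the author cites Majda–Bertozzi Thm 3.4
p. 104 and Cor. 3.2 p. 112) and Remark 2.4 (p. 89): the whole-space local theory package.** For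
`ν > 0` and a Clay datum «there exists a maximal time T* (possibly infinite) of existence of a unique
smooth solution»: EITHER a global solution in the class (classical on `ℝ³ × [0,∞)`, all `L²` Sobolev
norms bounded on every `[0,T]`) with bounded energy (2.7), OR a solution in the class on some
`[0,T*)`, `0 < T* < ∞`, with no continuation in the class past `T*`. (Uniqueness is not consumed and
not typed; (2.7) is the standard energy inequality, typed into this package because §4 does not
mention it.) Typist's flag: plausible (known theory).
[cite: Kyritsis2026, Lemma 2.1 and Theorem 2.1, pp. 89–90] -/
def Step_1 : Prop :=
  ∀ ν : ℝ, 0 < ν →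
    ∀ u₀ : EuclideanSpace ℝ (Fin 3) → EuclideanSpace ℝ (Fin 3), ContDiff ℝ ∞ u₀ →
      NSWave0.IsDivFree u₀ → HasRapidSpatialDecay u₀ →
      (∃ (u : ℝ → EuclideanSpace ℝ (Fin 3) → EuclideanSpace ℝ (Fin 3))
          (p : ℝ → EuclideanSpace ℝ (Fin 3) → ℝ),
          IsGlobalClassSolution ν u p ∧ u 0 = u₀ ∧ HasBoundedEnergy u) ∨
      (∃ T : ℝ, 0 < T ∧
        ∃ (u : ℝ → EuclideanSpace ℝ (Fin 3) → EuclideanSpace ℝ (Fin 3))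
          (p : ℝ → EuclideanSpace ℝ (Fin 3) → ℝ),
          IsLocalClassSolution ν T u p ∧ u 0 = u₀ ∧ ¬ HasSobolevExtensionPast ν u T)

/-- **Step 2 — Theorem 2.2 (pp. 90–91), the Beale–Kato–Majda criterion** («If the maximal time T* …
is finite, then necessarily … ∫₀^{T*} ‖ω‖_∞ dτ = +∞» (2.12); the author cites Majda–Bertozzi Thm 3.6
p. 115): verbatim the tree's named fact (discharged by
`lintegral_iSup_curl_eq_top_of_not_hasSobolevExtensionPast_holds`). Recalled by the paper; no typed
implication consumes it. Typist's flag: true (tree theorem).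
[cite: Kyritsis2026, Theorem 2.2 eq. (2.12), pp. 90–91] -/
def Step_2 : Prop :=
  Literature.Analysis.FluidPDE.lintegral_iSup_curl_eq_top_of_not_hasSobolevExtensionPast

/-- **Step 3 — the «Fefferman implicit hypothesis of velocities blow-up» (pp. 96–97: «a blowup in
finite time of the vorticity accumulation, will imply a blowup of the velocities in finite time … A
full proof … comes from the CKN theory of singularities») together with Lemma 3.2 (p. 91, Galdi: «It
is impossible … that there will be created in finite time by blow-up a singularity of the velocities
at the spatial infinite»):** for `ν > 0` and a Clay datum, a solution in the class on `[0,T*)`,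
`T* < ∞`, with no continuation in the class has a FINITE velocity blow-up point `S ∈ ℝ³`.
Typist's flag: plausible (known: `L^∞` blow-up criterion + ε-regularity + decay; non-trivial).
[cite: Kyritsis2026, Lemma 3.2 p. 91 and §4 pp. 96–97] -/
def Step_3 : Prop :=
  ∀ ν : ℝ, 0 < ν →
    ∀ u₀ : EuclideanSpace ℝ (Fin 3) → EuclideanSpace ℝ (Fin 3), ContDiff ℝ ∞ u₀ →
      NSWave0.IsDivFree u₀ → HasRapidSpatialDecay u₀ →
    ∀ T : ℝ, 0 < T →
    ∀ (u : ℝ → EuclideanSpace ℝ (Fin 3) → EuclideanSpace ℝ (Fin 3))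
      (p : ℝ → EuclideanSpace ℝ (Fin 3) → ℝ), IsLocalClassSolution ν T u p → u 0 = u₀ →
      ¬ HasSobolevExtensionPast ν u T →
      ∃ S : EuclideanSpace ℝ (Fin 3), IsVelocityBlowupPoint u T S

/-- **Step 4 — Lemma 3.1 (p. 91, «from the CKN theory»):** «Any finite time blow-up of velocities,
after the standard hypotheses …, cannot have singularities on all points of an open 3D, 2D or 1D
region. Any possible singularities must have total measure zero.» Typed for the velocity blow-up
points at the maximal time of a solution in the class: they form a Lebesgue-null set containing no
open ball. (Used only in the second contradiction of Theorem 3.4's proof, «the singularity is on all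
the ball B», p. 95.) Typist's flag: plausible (Caffarelli–Kohn–Nirenberg 1982 for suitable weak
solutions). [cite: Kyritsis2026, Lemma 3.1, p. 91] -/
def Step_4 : Prop :=
  ∀ ν : ℝ, 0 < ν → ∀ T : ℝ, 0 < T →
    ∀ (u : ℝ → EuclideanSpace ℝ (Fin 3) → EuclideanSpace ℝ (Fin 3))
      (p : ℝ → EuclideanSpace ℝ (Fin 3) → ℝ), IsLocalClassSolution ν T u p →
      volume {S : EuclideanSpace ℝ (Fin 3) | IsVelocityBlowupPoint u T S} = 0 ∧
        ∀ (x : EuclideanSpace ℝ (Fin 3)) (r : ℝ), 0 < r →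
          ¬ Metric.ball x r ⊆ {S | IsVelocityBlowupPoint u T S}

/-- **Step 5 — Lemma 3.3 (pp. 92–94), «1D INTEGRALS OF PRESSURE FORCES WILL BLOW-UP IN A FINITE
TIME VELOCITIES BLOW-UP»:** «Let any point S of velocity blow-up, created in finite time T* … Then
at time T* − δt, for a very small time δt (almost infinitesimal) just before the blow up, any path
P = AB from a fixed in time and space point A, till a point B (other than S), but sufficient close
to S, will define an 1D integral of pressure forces, which becomes infinite as B converges to S»
(also «if we weight the integral in polar coordinates by r²»; displayed support (3.4.0)–(3.4.4),
pp. 93–94: «‖u‖ ≥ C/R … a.e.», «‖p(x, T*−δτ)‖ ≥ C₂/r²», «‖F_p(x, T*−δτ)‖ ≥ C₃/r³», «‖I(F_p)‖ ≥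
C₄/r²», «≥ C₅|Log(r)|»). Typed for smooth unforced Navier–Stokes solutions (`ν > 0`) on
`ℝ³ × [0,T)` (periodic ones included — they are needed for Theorem B), with straight paths (a
sub-family of «any path»: weaker conclusion, more charitable) and SOME `δt ∈ (0,T)`: the absolute
work along the segment from `A` to `B` tends to `+∞` as `B → S`, `B ≠ S`. Typist's flag: suspicious —
see `step6_of_step5` (the conclusion contradicts the smoothness of `p(·, T−δt)`; the lemma holds iff
there is no blow-up point at all). [cite: Kyritsis2026, Lemma 3.3 and eqs. (3.4.0)–(3.4.4), pp. 92–94] -/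
def Step_5 : Prop :=
  ∀ ν : ℝ, 0 < ν → ∀ T : ℝ, 0 < T →
    ∀ (u : ℝ → EuclideanSpace ℝ (Fin 3) → EuclideanSpace ℝ (Fin 3))
      (p : ℝ → EuclideanSpace ℝ (Fin 3) → ℝ), IsClassicalNSSolutionOn (Ico 0 T) ν 0 u p →
    ∀ S : EuclideanSpace ℝ (Fin 3), IsVelocityBlowupPoint u T S →
      ∃ δ ∈ Ioo 0 T, ∀ A : EuclideanSpace ℝ (Fin 3),
        Tendsto (fun B => |pressureForceWork (p (T - δ)) A B|) (𝓝[≠] S) atTop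

/-- **Step 6 — THEOREM 3.4 (p. 94), «THE CRUCIAL THEOREM FOR THE SOLUTION», statement:** «There
cannot be created any finite point S of blow-up of velocities, within a finite time interval, after
the standard hypotheses of the formulation of the 4th Millennium problem about the Navier-Stokes
equations». Typed for smooth unforced Navier–Stokes solutions (`ν > 0`) on `ℝ³ × [0,T)` (the «standard
hypotheses» being those of (A) or (B); periodic solutions are whole-space solutions): no velocity
blow-up point at `T`. Printed proof (pp. 94–95): polar-coordinate integration of `F_p` over `B(S,R)`
«= +∞» by Lemma 3.3 ((3.4.5), (3.4.9)) against the divergence theorem «∫_B F_p dV = ∮_{∂B} p (u,n)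
dA», finite ((3.4.10)), plus Lemma 3.1. Typist's flag: open-strength as a statement (with Steps 1, 3
it is Clay (A)); in the kernel it FOLLOWS from `Step_5` by smoothness alone (`step6_of_step5`) and
implies `Step_5` vacuously (`step5_of_step6`). [cite: Kyritsis2026, Theorem 3.4, pp. 94–95] -/
def Step_6 : Prop :=
  ∀ ν : ℝ, 0 < ν → ∀ T : ℝ, 0 < T →
    ∀ (u : ℝ → EuclideanSpace ℝ (Fin 3) → EuclideanSpace ℝ (Fin 3))
      (p : ℝ → EuclideanSpace ℝ (Fin 3) → ℝ), IsClassicalNSSolutionOn (Ico 0 T) ν 0 u p →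
    ∀ S : EuclideanSpace ℝ (Fin 3), ¬ IsVelocityBlowupPoint u T S

/-- **Step 7 — the periodic package behind «(THEOREM B)»** (Remark 2.5 p. 90 and Remark 2.6 p. 91:
«obviously this proposition covers the periodic case too»; Lemma 3.2, p. 91: «we may as well
formulate the proof for the periodic case, which has compact fundamental region, so as to avoid
reasoning, about blow-ups at the infinite»; §4 p. 97): for `ν > 0` and a smooth divergence-free
ℤ³-periodic datum, EITHER a global classical solution on `ℝ³ × [0,∞)` with `u(·,t)`, `p(·,t)`
periodic, OR a classical solution on some `[0,T*)`, `0 < T* < ∞`, with `u`, `p` periodic, that has a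
velocity blow-up point at `T*`. Typist's flag: plausible (known: torus local theory, `L^∞` blow-up
criterion, compactness of the fundamental domain). [cite: Kyritsis2026, Remarks 2.5–2.6 pp. 90–91, Lemma 3.2 p. 91 and §4 p. 97] -/
def Step_7 : Prop :=
  ∀ ν : ℝ, 0 < ν →
    ∀ u₀ : EuclideanSpace ℝ (Fin 3) → EuclideanSpace ℝ (Fin 3), ContDiff ℝ ∞ u₀ →
      NSWave0.IsDivFree u₀ → IsLatticePeriodic u₀ →
      (∃ (u : ℝ → EuclideanSpace ℝ (Fin 3) → EuclideanSpace ℝ (Fin 3))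
          (p : ℝ → EuclideanSpace ℝ (Fin 3) → ℝ),
          IsClassicalNSSolutionOn (Ici 0) ν 0 u p ∧ u 0 = u₀ ∧
            ∀ t : ℝ, 0 ≤ t → IsLatticePeriodic (u t) ∧ IsLatticePeriodic (p t)) ∨
      (∃ T : ℝ, 0 < T ∧
        ∃ (u : ℝ → EuclideanSpace ℝ (Fin 3) → EuclideanSpace ℝ (Fin 3))
          (p : ℝ → EuclideanSpace ℝ (Fin 3) → ℝ),
          IsClassicalNSSolutionOn (Ico 0 T) ν 0 u p ∧ u 0 = u₀ ∧
            (∀ t ∈ Ico 0 T, IsLatticePeriodic (u t) ∧ IsLatticePeriodic (p t)) ∧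
            ∃ S : EuclideanSpace ℝ (Fin 3), IsVelocityBlowupPoint u T S)

/-! ## Kernel compositions of the paper's implications -/

/-- **Lemma 3.3 ⇒ Theorem 3.4, in the kernel — by smoothness at the pre-blow-up time.** If `S` were
a velocity blow-up point at `T`, Lemma 3.3 would give a time `T − δ ∈ (0,T)` at which the work of the
pressure forces along the segment from `S` to `B` diverges as `B → S`; but `p(·, T−δ)` is `C^∞`
(`IsClassicalNSSolutionOn.contDiff_pressure`), so by the gradient theorem that work is
`p(S) − p(B) → 0`. Hence Lemma 3.3, as printed at the fixed time `T* − δt`, can hold only because no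
blow-up point exists: its content coincides with Theorem 3.4 (`step5_iff_step6`). The paper's own
route ((3.4.5)–(3.4.10), divergence theorem on `B(S,R)`) is not typed.
[cite: Kyritsis2026, Lemma 3.3 pp. 92–94 and Theorem 3.4 pp. 94–95] -/
theorem step6_of_step5 (h5 : Step_5) : Step_6 := by
  intro ν hν T hT u p hsol S hS
  obtain ⟨δ, hδ, hdiv⟩ := h5 ν hν T hT u p hsol S hS
  have ht : T - δ ∈ Ico 0 T := ⟨by linarith [hδ.2], by linarith [hδ.1]⟩
  have hp : ContDiff ℝ ∞ (p (T - δ)) := hsol.contDiff_pressure ht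
  have hp1 : ContDiff ℝ 1 (p (T - δ)) := hp.of_le (by exact_mod_cast le_top)
  -- the work from S to B is p(S) − p(B), continuous in B, hence tends to 0 = p(S) − p(S)
  have hW : ∀ B, |pressureForceWork (p (T - δ)) S B| = |p (T - δ) S - p (T - δ) B| := fun B => by
    rw [pressureForceWork_eq hp1]
  have hcts : Tendsto (fun B => |p (T - δ) S - p (T - δ) B|) (𝓝[≠] S) (𝓝 0) := by
    have hc : Continuous fun B => |p (T - δ) S - p (T - δ) B| :=
      (continuous_const.sub hp.continuous).abs
    have := hc.tendsto S
    rw [sub_self, abs_zero] at this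
    exact this.mono_left nhdsWithin_le_nhds
  have hlim := hdiv S
  simp_rw [hW] at hlim
  exact hcts.not_tendsto (disjoint_nhds_atTop 0) hlim

/-- Theorem 3.4 ⇒ Lemma 3.3 (vacuously: there is no blow-up point to which the lemma could apply).
[cite: Kyritsis2026, Lemma 3.3 pp. 92–94 and Theorem 3.4 pp. 94–95] -/
theorem step5_of_step6 (h6 : Step_6) : Step_5 :=
  fun ν hν T hT u p hsol S hS => absurd hS (h6 ν hν T hT u p hsol S)

/-- **Lemma 3.3 and Theorem 3.4 have the same content** (kernel record of the vacuity of Lemma 3.3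
at the fixed pre-blow-up time). [cite: Kyritsis2026, Lemma 3.3 pp. 92–94 and Theorem 3.4 pp. 94–95] -/
theorem step5_iff_step6 : Step_5 ↔ Step_6 :=
  ⟨step6_of_step5, step5_of_step6⟩

/-- **§4 (pp. 95–97) COMPOSES: the claimed theorem from Steps 1–7** (hypotheses in step order; the
proof consumes `Step_1`, `Step_3`, `Step_5` via `step6_of_step5`, and `Step_7`): a finite-time loss
of smoothness would produce a finite velocity blow-up point (Fefferman implicit hypothesis with
Galdi's lemma on ℝ³, compactness on ℝ³/ℤ³), which Theorem 3.4 forbids; so every maximal solution is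
global, and (2.7) holds by the energy clause of Step 1. [cite: Kyritsis2026, §4, pp. 95–97] -/
theorem claim_of_steps :
    Step_1 → Step_2 → Step_3 → Step_4 → Step_5 → Step_6 → Step_7 → ClaimedTheorem := by
  intro h1 _ h3 _ h5 _ h7
  have h6 : Step_6 := step6_of_step5 h5
  refine ⟨fun ν hν u₀ hu₀ hdiv hdec => ?_, fun ν hν u₀ hu₀ hdiv hper => ?_⟩
  · -- (THEOREM A)
    rcases h1 ν hν u₀ hu₀ hdiv hdec with ⟨u, p, hglob, h0, hE⟩ | ⟨T, hT, u, p, hsol, h0, hmax⟩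
    · exact ⟨u, p, hglob.1.smooth_velocity, hglob.1.smooth_pressure,
        ⟨fun t ht x => hglob.1.momentum t ht x, fun t ht => hglob.1.divFree t ht, h0⟩, hE⟩
    · exfalso
      obtain ⟨S, hS⟩ := h3 ν hν u₀ hu₀ hdiv hdec T hT u p hsol h0 hmax
      exact h6 ν hν T hT u p hsol.1 S hS
  · -- (THEOREM B)
    rcases h7 ν hν u₀ hu₀ hdiv hper with ⟨u, p, hsol, h0, hperiodic⟩ | ⟨T, hT, u, p, hsol, h0, -, S, hS⟩
    · exact ⟨u, p, hsol.smooth_velocity, hsol.smooth_pressure,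
        ⟨fun t ht x => hsol.momentum t ht x, fun t ht => hsol.divFree t ht, h0⟩, hperiodic⟩
    · exfalso
      exact h6 ν hν T hT u p hsol S hS


/-! ## Revision 2 (append-only): the displayed chain one level down — (3.4.0)–(3.4.2) p. 93 and
(3.4.9)/(3.4.10) p. 95 (referee lane 1 pre-verdict advice, `claims/Kyritsis2026/RETYPE.md` v0) -/

/-- The «pressure forces» field `F_p = −∇p(·,t)` of a pressure `p` at time `t` (pp. 92–93, eq.
(3.4.2); the momentum equation's `−∇p`). [cite: Kyritsis2026, eq. (3.4.2), p. 93] -/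
def pressureForce (p : ℝ → EuclideanSpace ℝ (Fin 3) → ℝ) (t : ℝ) (x : EuclideanSpace ℝ (Fin 3)) :
    EuclideanSpace ℝ (Fin 3) :=
  -(gradient (p t) x)

/-- **Step 8 — eqs. (3.4.0)–(3.4.2), p. 93 (the displayed support of Lemma 3.3; logically between
Step 4 and Step 5):** «Thus for a sufficient small ball around S, and almost every where ‖u‖ ≥ C/R
where R² = ‖x−S‖² + ‖δt‖²» (3.4.0, attributed to Caffarelli–Kohn–Nirenberg p. 795 «near a singular
point ‖u‖ ≥ C/r»); «the pressure diverges with spatial speed ‖p(x, T*−δτ)‖ ≥ C₂/r², sufficient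
close to S, and a.e.» (3.4.1, from «p scales as u²»); «the pressure forces … ‖F_p(x, T*−δτ)‖ ≥
C₃/r³, sufficient close to S, and a.e.» (3.4.2), `r = ‖x − S‖`. Typed at SOME time `T − δ`,
`δ ∈ (0,T)`, on SOME ball, with SOME positive constants (all existential = most charitable), for
smooth unforced Navier–Stokes solutions on `ℝ³ × [0,T)` with a velocity blow-up point `S` at `T`
(junk value: at `x = S` the right-hand sides of (3.4.1)–(3.4.2) are `C/0 = 0`). Typist's flag:
suspicious — (3.4.0) is not what CKN prove (a bound on scale-invariant cylinder quantities along the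
approach to `(S,T*)`), and (3.4.1) contradicts the continuity of `p(·,T−δ)` at `S` whenever
instantiated (`step6_of_step8`). [cite: Kyritsis2026, eqs. (3.4.0)–(3.4.2), p. 93] -/
def Step_8 : Prop :=
  ∀ ν : ℝ, 0 < ν → ∀ T : ℝ, 0 < T →
    ∀ (u : ℝ → EuclideanSpace ℝ (Fin 3) → EuclideanSpace ℝ (Fin 3))
      (p : ℝ → EuclideanSpace ℝ (Fin 3) → ℝ), IsClassicalNSSolutionOn (Ico 0 T) ν 0 u p →
    ∀ S : EuclideanSpace ℝ (Fin 3), IsVelocityBlowupPoint u T S →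
      ∃ δ ∈ Ioo 0 T, ∃ ρ : ℝ, 0 < ρ ∧ ∃ C₁ : ℝ, 0 < C₁ ∧ ∃ C₂ : ℝ, 0 < C₂ ∧ ∃ C₃ : ℝ, 0 < C₃ ∧
        ∀ᵐ x ∂(volume.restrict (Metric.ball S ρ)),
          C₁ / Real.sqrt (‖x - S‖ ^ 2 + δ ^ 2) ≤ ‖u (T - δ) x‖ ∧
          C₂ / ‖x - S‖ ^ 2 ≤ |p (T - δ) x| ∧
          C₃ / ‖x - S‖ ^ 3 ≤ ‖pressureForce p (T - δ) x‖

/-- **Step 9 — eq. (3.4.9), p. 95 (inside the proof of THEOREM 3.4; logically between Step 5 and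
Step 6):** «Now integrate, with this parametrization (radii first then ball surface) the pressure
forces F_p … (3.4.5) ∫∫∫_B F dV = ∫∫_{∂B}(∫_{SA} F(r,θ,φ) r² dr) sinθ dθ dφ … Because … the 1D path
integral in the integral iteration, will blow up for all points A, then we conclude that this will
happen for the 3D integral as well … = +∞ (3.4.9)», at time `T* − δt`, over the ball `B(S,R)` with
«R sufficient small». Typed in the WORK reading that the author's next line (3.4.10) fixes («by the
divergence theorem, and the identity (∇,pu) = (u,∇p) + p(∇,u) … the 3D integral is equal to …
∫∫_{∂B} p (u,n) dA … represents the energy being pushed across the spherical surface»), junk-value-safe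
(referee lane 1): the lower Lebesgue integral of `|F_p · u|` over the closed ball is `⊤`, for SOME
`δ ∈ (0,T)` and SOME `R > 0`. Typist's flag: suspicious — at a fixed pre-blow-up time the integrand
is continuous on the compact ball (`workIntegral_lt_top`), which is the finiteness the print itself
invokes at (3.4.10); so (3.4.9) holds only when there is no blow-up point (`step9_iff_step6`).
[cite: Kyritsis2026, eqs. (3.4.5), (3.4.9), p. 95] -/
def Step_9 : Prop :=
  ∀ ν : ℝ, 0 < ν → ∀ T : ℝ, 0 < T →
    ∀ (u : ℝ → EuclideanSpace ℝ (Fin 3) → EuclideanSpace ℝ (Fin 3))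
      (p : ℝ → EuclideanSpace ℝ (Fin 3) → ℝ), IsClassicalNSSolutionOn (Ico 0 T) ν 0 u p →
    ∀ S : EuclideanSpace ℝ (Fin 3), IsVelocityBlowupPoint u T S →
      ∃ δ ∈ Ioo 0 T, ∃ R : ℝ, 0 < R ∧
        (∫⁻ x in Metric.closedBall S R, ‖inner ℝ (pressureForce p (T - δ) x) (u (T - δ) x)‖ₑ) = ⊤

/-- **(3.4.10), p. 95 — the finiteness the print invokes, in the kernel:** at every time `t < T` of
a smooth solution on `[0,T)` the work integral `∫_{B̄(S,R)} |F_p · u|` over any closed ball is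
finite (continuous integrand on a compact set). The print's VALUE for it — the boundary flux
«∫∫_{∂B} p (u,n) dA» by the divergence theorem with `div u = 0` — is not typed; only its finiteness
is used in Theorem 3.4's reductio. [cite: Kyritsis2026, eq. (3.4.10), p. 95] -/
theorem workIntegral_lt_top {ν T : ℝ}
    {u : ℝ → EuclideanSpace ℝ (Fin 3) → EuclideanSpace ℝ (Fin 3)}
    {p : ℝ → EuclideanSpace ℝ (Fin 3) → ℝ} (hsol : IsClassicalNSSolutionOn (Ico 0 T) ν 0 u p)
    {t : ℝ} (ht : t ∈ Ico 0 T) (S : EuclideanSpace ℝ (Fin 3)) (R : ℝ) :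
    (∫⁻ x in Metric.closedBall S R, ‖inner ℝ (pressureForce p t x) (u t x)‖ₑ) < ⊤ := by
  have hp : ContDiff ℝ ∞ (p t) := hsol.contDiff_pressure ht
  have hu : Continuous (u t) := (hsol.contDiff_velocity ht).continuous
  have hF : Continuous (pressureForce p t) := by
    unfold pressureForce gradient
    exact ((InnerProductSpace.toDual ℝ (EuclideanSpace ℝ (Fin 3))).symm.continuous.comp
      (hp.continuous_fderiv (by simp))).neg
  have hc : Continuous fun x => inner ℝ (pressureForce p t x) (u t x) := hF.inner hu
  have hi : IntegrableOn (fun x => inner ℝ (pressureForce p t x) (u t x))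
      (Metric.closedBall S R) volume :=
    hc.continuousOn.integrableOn_compact (isCompact_closedBall S R)
  exact hi.2

/-- **THEOREM 3.4's printed reductio, in the kernel: (3.4.9) against (3.4.10).** If `S` were a
blow-up point, (3.4.9) would make the work integral over some ball at some pre-blow-up time
infinite, while it is finite there (`workIntegral_lt_top`); so there is no blow-up point. (The
second printed contradiction, «the singularity is on all the ball B» against Lemma 3.1, is not
needed.) [cite: Kyritsis2026, proof of Theorem 3.4, eqs. (3.4.9)–(3.4.10), p. 95] -/
theorem step6_of_step9 (h9 : Step_9) : Step_6 := by
  intro ν hν T hT u p hsol S hS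
  obtain ⟨δ, hδ, R, _, hinf⟩ := h9 ν hν T hT u p hsol S hS
  have ht : T - δ ∈ Ico 0 T := ⟨by linarith [hδ.2], by linarith [hδ.1]⟩
  exact (workIntegral_lt_top hsol ht S R).ne hinf

/-- Theorem 3.4 ⇒ (3.4.9), vacuously. [cite: Kyritsis2026, eq. (3.4.9), p. 95] -/
theorem step9_of_step6 (h6 : Step_6) : Step_9 :=
  fun ν hν T hT u p hsol S hS => absurd hS (h6 ν hν T hT u p hsol S)

/-- **(3.4.9) and Theorem 3.4 have the same content.** [cite: Kyritsis2026, eq. (3.4.9) and Theorem 3.4, pp. 94–95] -/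
theorem step9_iff_step6 : Step_9 ↔ Step_6 :=
  ⟨step6_of_step9, step9_of_step6⟩

/-- **(3.4.1) is never instantiated: Step 8 ⇒ Theorem 3.4 by continuity of the pressure slice.**
If `S` were a blow-up point, (3.4.1) would give `|p(x,T−δ)| ≥ C₂/‖x−S‖²` for a.e. `x` in a ball
around `S`; but `p(·,T−δ)` is continuous, hence bounded by some `M` on the closed unit ball around
`S`, and on the punctured ball of radius `r₀ < min(1, ρ, √(C₂/(M+1)))` the inequality fails at EVERY
point — a set of positive measure. [cite: Kyritsis2026, eq. (3.4.1), p. 93] -/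
theorem step6_of_step8 (h8 : Step_8) : Step_6 := by
  intro ν hν T hT u p hsol S hS
  obtain ⟨δ, hδ, ρ, hρ, C₁, _, C₂, hC₂, C₃, _, hae⟩ := h8 ν hν T hT u p hsol S hS
  have ht : T - δ ∈ Ico 0 T := ⟨by linarith [hδ.2], by linarith [hδ.1]⟩
  have hpc : Continuous (p (T - δ)) := (hsol.contDiff_pressure ht).continuous
  -- a bound M for |p(T-δ)| on the closed unit ball around S
  obtain ⟨M, hM⟩ : ∃ M : ℝ, ∀ x ∈ Metric.closedBall S 1, |p (T - δ) x| ≤ M := by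
    obtain ⟨M, hM⟩ := (isCompact_closedBall S 1).exists_bound_of_continuousOn hpc.continuousOn
    exact ⟨M, fun x hx => by simpa [Real.norm_eq_abs] using hM x hx⟩
  have hM0 : 0 ≤ M := (abs_nonneg _).trans (hM S (Metric.mem_closedBall_self zero_le_one))
  -- a radius r₀ below 1, ρ and √(C₂/(M+1))
  set r₀ : ℝ := min (min 1 ρ) (Real.sqrt (C₂ / (M + 1))) / 2 with hr₀
  have hsq : 0 < Real.sqrt (C₂ / (M + 1)) := Real.sqrt_pos.mpr (by positivity)
  have hr₀pos : 0 < r₀ := by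
    rw [hr₀]; exact div_pos (lt_min (lt_min one_pos hρ) hsq) two_pos
  have hr₀1 : r₀ < 1 := by
    rw [hr₀]
    have := min_le_left (min 1 ρ) (Real.sqrt (C₂ / (M + 1)))
    have := min_le_left (1 : ℝ) ρ
    linarith
  have hr₀ρ : r₀ < ρ := by
    rw [hr₀]
    have := min_le_left (min 1 ρ) (Real.sqrt (C₂ / (M + 1)))
    have := min_le_right (1 : ℝ) ρ
    linarith
  have hr₀s : r₀ < Real.sqrt (C₂ / (M + 1)) := by
    rw [hr₀]
    have := min_le_right (min 1 ρ) (Real.sqrt (C₂ / (M + 1)))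
    linarith
  -- on the punctured ball of radius r₀ the inequality (3.4.1) fails everywhere
  have hfail : ∀ x ∈ Metric.ball S r₀ \ {S}, ¬ (C₂ / ‖x - S‖ ^ 2 ≤ |p (T - δ) x|) := by
    rintro x ⟨hx, hxS⟩ hle
    have hd : 0 < ‖x - S‖ := norm_pos_iff.mpr (sub_ne_zero.mpr hxS)
    have hdx : ‖x - S‖ < r₀ := by rwa [Metric.mem_ball, dist_eq_norm] at hx
    have hx1 : x ∈ Metric.closedBall S 1 := by
      rw [Metric.mem_closedBall, dist_eq_norm]; linarith
    have h1 : |p (T - δ) x| ≤ M := hM x hx1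
    -- ‖x − S‖² < C₂/(M+1), hence C₂/‖x−S‖² > M + 1
    have h2 : ‖x - S‖ ^ 2 < C₂ / (M + 1) := by
      have h3 : ‖x - S‖ < Real.sqrt (C₂ / (M + 1)) := hdx.trans hr₀s
      have h4 : ‖x - S‖ ^ 2 < Real.sqrt (C₂ / (M + 1)) ^ 2 := by
        exact pow_lt_pow_left₀ h3 hd.le two_ne_zero
      rwa [Real.sq_sqrt (by positivity)] at h4
    have h5 : M + 1 < C₂ / ‖x - S‖ ^ 2 := by
      rw [lt_div_iff₀ (by positivity)]
      have := (lt_div_iff₀ (by positivity : (0 : ℝ) < M + 1)).mp h2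
      linarith [this]
    linarith
  -- but the failure set is null for the restricted measure, while the punctured ball is not
  have hnull : volume.restrict (Metric.ball S ρ) {x | ¬ (C₁ / Real.sqrt (‖x - S‖ ^ 2 + δ ^ 2) ≤
      ‖u (T - δ) x‖ ∧ C₂ / ‖x - S‖ ^ 2 ≤ |p (T - δ) x| ∧
      C₃ / ‖x - S‖ ^ 3 ≤ ‖pressureForce p (T - δ) x‖)} = 0 := by
    rw [← ae_iff]; exact hae
  have hsub : Metric.ball S r₀ \ {S} ⊆ {x | ¬ (C₁ / Real.sqrt (‖x - S‖ ^ 2 + δ ^ 2) ≤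
      ‖u (T - δ) x‖ ∧ C₂ / ‖x - S‖ ^ 2 ≤ |p (T - δ) x| ∧
      C₃ / ‖x - S‖ ^ 3 ≤ ‖pressureForce p (T - δ) x‖)} := fun x hx h => hfail x hx h.2.1
  have hzero : volume.restrict (Metric.ball S ρ) (Metric.ball S r₀ \ {S}) = 0 :=
    measure_mono_null hsub hnull
  rw [Measure.restrict_apply' Metric.isOpen_ball.measurableSet] at hzero
  have hinter : (Metric.ball S r₀ \ {S}) ∩ Metric.ball S ρ = Metric.ball S r₀ \ {S} := by
    exact inter_eq_left.mpr (Set.sdiff_subset.trans (Metric.ball_subset_ball hr₀ρ.le))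
  rw [hinter, measure_sdiff_null (measure_singleton S)] at hzero
  exact (Metric.measure_ball_pos volume S hr₀pos).ne' hzero

/-- Theorem 3.4 ⇒ (3.4.0)–(3.4.2), vacuously. [cite: Kyritsis2026, eqs. (3.4.0)–(3.4.2), p. 93] -/
theorem step8_of_step6 (h6 : Step_6) : Step_8 :=
  fun ν hν T hT u p hsol S hS => absurd hS (h6 ν hν T hT u p hsol S)

/-- **(3.4.0)–(3.4.2) and Theorem 3.4 have the same content.** [cite: Kyritsis2026, eqs. (3.4.0)–(3.4.2) p. 93 and Theorem 3.4 p. 94] -/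
theorem step8_iff_step6 : Step_8 ↔ Step_6 :=
  ⟨step6_of_step8, step8_of_step6⟩

/-- **The claimed theorem from all nine typed steps** (hypotheses in step order; Steps 8–9 are the
displayed intermediates appended in revision 2 and are not needed beyond `claim_of_steps`).
[cite: Kyritsis2026, §4, pp. 95–97] -/
theorem claim_of_all_steps :
    Step_1 → Step_2 → Step_3 → Step_4 → Step_5 → Step_6 → Step_7 → Step_8 → Step_9 →
      ClaimedTheorem :=
  fun h1 h2 h3 h4 h5 h6 h7 _ _ => claim_of_steps h1 h2 h3 h4 h5 h6 h7


/-! ## Revision 3 (append-only): the print's class — «after the standard hypotheses of the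
formulation of the 4th Millennium problem» (p. 94) (referee lane 1 F3, lead rulings 18:46:28Z and
19:09:27Z; `InPrintClass`, `Step5C`, `Step6C` and their glue verbatim from ns-claims-ref-1) -/

/-- The print's class (Thm 3.4 p. 94: «the standard hypotheses of the formulation of the 4th
Millennium problem»): a solution in the paper's own (A)-class (`IsLocalClassSolution`, Thm 2.1)
OR a classical ℤ³-periodic solution ((B)-class, Remarks 2.5–2.6 / Lemma 3.2).
[cite: Kyritsis2026, Theorem 3.4, p. 94] -/
def InPrintClass (ν T : ℝ) (u : ℝ → EuclideanSpace ℝ (Fin 3) → EuclideanSpace ℝ (Fin 3))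
    (p : ℝ → EuclideanSpace ℝ (Fin 3) → ℝ) : Prop :=
  IsLocalClassSolution ν T u p ∨
    (IsClassicalNSSolutionOn (Ico 0 T) ν 0 u p ∧
      ∀ t ∈ Ico 0 T, IsLatticePeriodic (u t) ∧ IsLatticePeriodic (p t))

/-- A solution in the print's class is a classical solution on `[0,T)`. [cite: Kyritsis2026, Theorem 3.4, p. 94] -/
theorem InPrintClass.classical {ν T : ℝ}
    {u : ℝ → EuclideanSpace ℝ (Fin 3) → EuclideanSpace ℝ (Fin 3)}
    {p : ℝ → EuclideanSpace ℝ (Fin 3) → ℝ} (h : InPrintClass ν T u p) :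
    IsClassicalNSSolutionOn (Ico 0 T) ν 0 u p :=
  h.elim (fun h => h.1) (fun h => h.1)

/-- **Lemma 3.3 (pp. 92–94) restricted to the print's class** — the charitable, print-faithful
form of `Step_5`. [cite: Kyritsis2026, Lemma 3.3, pp. 92–94] -/
def Step5C : Prop :=
  ∀ ν : ℝ, 0 < ν → ∀ T : ℝ, 0 < T →
    ∀ (u : ℝ → EuclideanSpace ℝ (Fin 3) → EuclideanSpace ℝ (Fin 3))
      (p : ℝ → EuclideanSpace ℝ (Fin 3) → ℝ), InPrintClass ν T u p →
    ∀ S : EuclideanSpace ℝ (Fin 3), IsVelocityBlowupPoint u T S →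
      ∃ δ ∈ Ioo 0 T, ∀ A : EuclideanSpace ℝ (Fin 3),
        Tendsto (fun B => |pressureForceWork (p (T - δ)) A B|) (𝓝[≠] S) atTop

/-- **Theorem 3.4 (pp. 94–95) restricted to the print's class** — the print-faithful form of
`Step_6`. [cite: Kyritsis2026, Theorem 3.4, pp. 94–95] -/
def Step6C : Prop :=
  ∀ ν : ℝ, 0 < ν → ∀ T : ℝ, 0 < T →
    ∀ (u : ℝ → EuclideanSpace ℝ (Fin 3) → EuclideanSpace ℝ (Fin 3))
      (p : ℝ → EuclideanSpace ℝ (Fin 3) → ℝ), InPrintClass ν T u p →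
    ∀ S : EuclideanSpace ℝ (Fin 3), ¬ IsVelocityBlowupPoint u T S

/-- **Eqs. (3.4.0)–(3.4.2) (p. 93) restricted to the print's class** — the print-faithful form of
`Step_8` (verdict-of-record locator, lead 19:09:27Z). [cite: Kyritsis2026, eqs. (3.4.0)–(3.4.2), p. 93] -/
def Step8C : Prop :=
  ∀ ν : ℝ, 0 < ν → ∀ T : ℝ, 0 < T →
    ∀ (u : ℝ → EuclideanSpace ℝ (Fin 3) → EuclideanSpace ℝ (Fin 3))
      (p : ℝ → EuclideanSpace ℝ (Fin 3) → ℝ), InPrintClass ν T u p →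
    ∀ S : EuclideanSpace ℝ (Fin 3), IsVelocityBlowupPoint u T S →
      ∃ δ ∈ Ioo 0 T, ∃ ρ : ℝ, 0 < ρ ∧ ∃ C₁ : ℝ, 0 < C₁ ∧ ∃ C₂ : ℝ, 0 < C₂ ∧ ∃ C₃ : ℝ, 0 < C₃ ∧
        ∀ᵐ x ∂(volume.restrict (Metric.ball S ρ)),
          C₁ / Real.sqrt (‖x - S‖ ^ 2 + δ ^ 2) ≤ ‖u (T - δ) x‖ ∧
          C₂ / ‖x - S‖ ^ 2 ≤ |p (T - δ) x| ∧
          C₃ / ‖x - S‖ ^ 3 ≤ ‖pressureForce p (T - δ) x‖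

/-- **Eq. (3.4.9) (p. 95) restricted to the print's class** — the print-faithful form of `Step_9`.
[cite: Kyritsis2026, eq. (3.4.9), p. 95] -/
def Step9C : Prop :=
  ∀ ν : ℝ, 0 < ν → ∀ T : ℝ, 0 < T →
    ∀ (u : ℝ → EuclideanSpace ℝ (Fin 3) → EuclideanSpace ℝ (Fin 3))
      (p : ℝ → EuclideanSpace ℝ (Fin 3) → ℝ), InPrintClass ν T u p →
    ∀ S : EuclideanSpace ℝ (Fin 3), IsVelocityBlowupPoint u T S →
      ∃ δ ∈ Ioo 0 T, ∃ R : ℝ, 0 < R ∧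
        (∫⁻ x in Metric.closedBall S R, ‖inner ℝ (pressureForce p (T - δ) x) (u (T - δ) x)‖ₑ) = ⊤

/-- The wide step implies its class-restricted form. [cite: Kyritsis2026, Lemma 3.3, pp. 92–94] -/
theorem step5C_of_step5 (h : Step_5) : Step5C :=
  fun ν hν T hT u p hc S hS => h ν hν T hT u p hc.classical S hS

/-- The wide step implies its class-restricted form. [cite: Kyritsis2026, Theorem 3.4, pp. 94–95] -/
theorem step6C_of_step6 (h : Step_6) : Step6C :=
  fun ν hν T hT u p hc S hS => h ν hν T hT u p hc.classical S hS

/-- The wide step implies its class-restricted form. [cite: Kyritsis2026, eqs. (3.4.0)–(3.4.2), p. 93] -/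
theorem step8C_of_step8 (h : Step_8) : Step8C :=
  fun ν hν T hT u p hc S hS => h ν hν T hT u p hc.classical S hS

/-- The wide step implies its class-restricted form. [cite: Kyritsis2026, eq. (3.4.9), p. 95] -/
theorem step9C_of_step9 (h : Step_9) : Step9C :=
  fun ν hν T hT u p hc S hS => h ν hν T hT u p hc.classical S hS

/-- **The kernel argument survives the class restriction verbatim**: the conclusion of Lemma 3.3 is
unsatisfiable for a `C^∞` pressure slice (gradient theorem), so `Step5C` can only hold because no
blow-up point exists in the class. [cite: Kyritsis2026, Lemma 3.3 pp. 92–94 and Theorem 3.4 pp. 94–95] -/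
theorem step6C_of_step5C (h5 : Step5C) : Step6C := by
  intro ν hν T hT u p hc S hS
  obtain ⟨δ, hδ, hdiv⟩ := h5 ν hν T hT u p hc S hS
  have ht : T - δ ∈ Ico 0 T := ⟨by linarith [hδ.2], by linarith [hδ.1]⟩
  have hp : ContDiff ℝ ∞ (p (T - δ)) := hc.classical.contDiff_pressure ht
  have hp1 : ContDiff ℝ 1 (p (T - δ)) := hp.of_le (by exact_mod_cast le_top)
  have hW : ∀ B, |pressureForceWork (p (T - δ)) S B| = |p (T - δ) S - p (T - δ) B| := fun B => by
    rw [pressureForceWork_eq hp1]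
  have hcts : Tendsto (fun B => |p (T - δ) S - p (T - δ) B|) (𝓝[≠] S) (𝓝 0) := by
    have hc' : Continuous fun B => |p (T - δ) S - p (T - δ) B| :=
      (continuous_const.sub hp.continuous).abs
    have := hc'.tendsto S
    rw [sub_self, abs_zero] at this
    exact this.mono_left nhdsWithin_le_nhds
  have hlim := hdiv S
  simp_rw [hW] at hlim
  exact hcts.not_tendsto (disjoint_nhds_atTop 0) hlim

/-- Theorem 3.4 ⇒ Lemma 3.3 in the print's class (vacuously). [cite: Kyritsis2026, Lemma 3.3, pp. 92–94] -/
theorem step5C_of_step6C (h6 : Step6C) : Step5C :=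
  fun ν hν T hT u p hc S hS => absurd hS (h6 ν hν T hT u p hc S)

/-- **In the print's class, Lemma 3.3 and Theorem 3.4 still have the same content** (the
circularity is not an artefact of the wide typing). [cite: Kyritsis2026, Lemma 3.3 pp. 92–94 and Theorem 3.4 pp. 94–95] -/
theorem step5C_iff_step6C : Step5C ↔ Step6C :=
  ⟨step6C_of_step5C, step5C_of_step6C⟩

/-- **(3.4.9) against (3.4.10) in the print's class** (Theorem 3.4's printed reductio): the work
integral at a pre-blow-up time is finite (`workIntegral_lt_top`). [cite: Kyritsis2026, eqs. (3.4.9)–(3.4.10), p. 95] -/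
theorem step6C_of_step9C (h9 : Step9C) : Step6C := by
  intro ν hν T hT u p hc S hS
  obtain ⟨δ, hδ, R, _, hinf⟩ := h9 ν hν T hT u p hc S hS
  have ht : T - δ ∈ Ico 0 T := ⟨by linarith [hδ.2], by linarith [hδ.1]⟩
  exact (workIntegral_lt_top hc.classical ht S R).ne hinf

/-- Theorem 3.4 ⇒ (3.4.9) in the print's class (vacuously). [cite: Kyritsis2026, eq. (3.4.9), p. 95] -/
theorem step9C_of_step6C (h6 : Step6C) : Step9C :=
  fun ν hν T hT u p hc S hS => absurd hS (h6 ν hν T hT u p hc S)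

/-- **In the print's class, (3.4.9) and Theorem 3.4 have the same content.**
[cite: Kyritsis2026, eq. (3.4.9) and Theorem 3.4, pp. 94–95] -/
theorem step9C_iff_step6C : Step9C ↔ Step6C :=
  ⟨step6C_of_step9C, step9C_of_step6C⟩

/-- **(3.4.1) is never instantiated in the print's class either**: `Step8C ⇒ Step6C` by continuity
of the pressure slice (the argument of `step6_of_step8`, which uses only the classical-solution
smoothness at the pre-blow-up time). [cite: Kyritsis2026, eq. (3.4.1), p. 93] -/
theorem step6C_of_step8C (h8 : Step8C) : Step6C := by
  intro ν hν T hT u p hc S hS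
  obtain ⟨δ, hδ, ρ, hρ, C₁, _, C₂, hC₂, C₃, _, hae⟩ := h8 ν hν T hT u p hc S hS
  have ht : T - δ ∈ Ico 0 T := ⟨by linarith [hδ.2], by linarith [hδ.1]⟩
  have hpc : Continuous (p (T - δ)) := (hc.classical.contDiff_pressure ht).continuous
  obtain ⟨M, hM⟩ : ∃ M : ℝ, ∀ x ∈ Metric.closedBall S 1, |p (T - δ) x| ≤ M := by
    obtain ⟨M, hM⟩ := (isCompact_closedBall S 1).exists_bound_of_continuousOn hpc.continuousOn
    exact ⟨M, fun x hx => by simpa [Real.norm_eq_abs] using hM x hx⟩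
  have hM0 : 0 ≤ M := (abs_nonneg _).trans (hM S (Metric.mem_closedBall_self zero_le_one))
  set r₀ : ℝ := min (min 1 ρ) (Real.sqrt (C₂ / (M + 1))) / 2 with hr₀
  have hsq : 0 < Real.sqrt (C₂ / (M + 1)) := Real.sqrt_pos.mpr (by positivity)
  have hr₀pos : 0 < r₀ := by
    rw [hr₀]; exact div_pos (lt_min (lt_min one_pos hρ) hsq) two_pos
  have hr₀1 : r₀ < 1 := by
    rw [hr₀]
    have := min_le_left (min 1 ρ) (Real.sqrt (C₂ / (M + 1)))
    have := min_le_left (1 : ℝ) ρ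
    linarith
  have hr₀ρ : r₀ < ρ := by
    rw [hr₀]
    have := min_le_left (min 1 ρ) (Real.sqrt (C₂ / (M + 1)))
    have := min_le_right (1 : ℝ) ρ
    linarith
  have hr₀s : r₀ < Real.sqrt (C₂ / (M + 1)) := by
    rw [hr₀]
    have := min_le_right (min 1 ρ) (Real.sqrt (C₂ / (M + 1)))
    linarith
  have hfail : ∀ x ∈ Metric.ball S r₀ \ {S}, ¬ (C₂ / ‖x - S‖ ^ 2 ≤ |p (T - δ) x|) := by
    rintro x ⟨hx, hxS⟩ hle
    have hd : 0 < ‖x - S‖ := norm_pos_iff.mpr (sub_ne_zero.mpr hxS)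
    have hdx : ‖x - S‖ < r₀ := by rwa [Metric.mem_ball, dist_eq_norm] at hx
    have hx1 : x ∈ Metric.closedBall S 1 := by
      rw [Metric.mem_closedBall, dist_eq_norm]; linarith
    have h1 : |p (T - δ) x| ≤ M := hM x hx1
    have h2 : ‖x - S‖ ^ 2 < C₂ / (M + 1) := by
      have h3 : ‖x - S‖ < Real.sqrt (C₂ / (M + 1)) := hdx.trans hr₀s
      have h4 : ‖x - S‖ ^ 2 < Real.sqrt (C₂ / (M + 1)) ^ 2 := by
        exact pow_lt_pow_left₀ h3 hd.le two_ne_zero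
      rwa [Real.sq_sqrt (by positivity)] at h4
    have h5 : M + 1 < C₂ / ‖x - S‖ ^ 2 := by
      rw [lt_div_iff₀ (by positivity)]
      have := (lt_div_iff₀ (by positivity : (0 : ℝ) < M + 1)).mp h2
      linarith [this]
    linarith
  have hnull : volume.restrict (Metric.ball S ρ) {x | ¬ (C₁ / Real.sqrt (‖x - S‖ ^ 2 + δ ^ 2) ≤
      ‖u (T - δ) x‖ ∧ C₂ / ‖x - S‖ ^ 2 ≤ |p (T - δ) x| ∧
      C₃ / ‖x - S‖ ^ 3 ≤ ‖pressureForce p (T - δ) x‖)} = 0 := by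
    rw [← ae_iff]; exact hae
  have hsub : Metric.ball S r₀ \ {S} ⊆ {x | ¬ (C₁ / Real.sqrt (‖x - S‖ ^ 2 + δ ^ 2) ≤
      ‖u (T - δ) x‖ ∧ C₂ / ‖x - S‖ ^ 2 ≤ |p (T - δ) x| ∧
      C₃ / ‖x - S‖ ^ 3 ≤ ‖pressureForce p (T - δ) x‖)} := fun x hx h => hfail x hx h.2.1
  have hzero : volume.restrict (Metric.ball S ρ) (Metric.ball S r₀ \ {S}) = 0 :=
    measure_mono_null hsub hnull
  rw [Measure.restrict_apply' Metric.isOpen_ball.measurableSet] at hzero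
  have hinter : (Metric.ball S r₀ \ {S}) ∩ Metric.ball S ρ = Metric.ball S r₀ \ {S} := by
    exact inter_eq_left.mpr (Set.sdiff_subset.trans (Metric.ball_subset_ball hr₀ρ.le))
  rw [hinter, measure_sdiff_null (measure_singleton S)] at hzero
  exact (Metric.measure_ball_pos volume S hr₀pos).ne' hzero

/-- Theorem 3.4 ⇒ (3.4.0)–(3.4.2) in the print's class (vacuously). [cite: Kyritsis2026, eqs. (3.4.0)–(3.4.2), p. 93] -/
theorem step8C_of_step6C (h6 : Step6C) : Step8C :=
  fun ν hν T hT u p hc S hS => absurd hS (h6 ν hν T hT u p hc S)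

/-- **In the print's class, (3.4.0)–(3.4.2) and Theorem 3.4 have the same content** — the
verdict-of-record equivalence (lead 19:09:27Z: «first failing step = Step_8C ((3.4.0) p. 93;
load-bearing Lemma 3.3 = Step_5C pp. 92–94), class = vacuous»).
[cite: Kyritsis2026, eqs. (3.4.0)–(3.4.2) p. 93 and Theorem 3.4 p. 94] -/
theorem step8C_iff_step6C : Step8C ↔ Step6C :=
  ⟨step6C_of_step8C, step8C_of_step6C⟩

/-- **The paper's §4 composition goes through from the class-restricted lemma**: `Step_1`,
`Step_3`, `Step5C`, `Step_7 ⊢ ClaimedTheorem` (the solutions produced by Steps 1/3 are in the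
(A)-class, those of Step 7 are periodic). [cite: Kyritsis2026, §4, pp. 95–97] -/
theorem claim_of_stepsC (h1 : Step_1) (h3 : Step_3) (h5 : Step5C) (h7 : Step_7) :
    ClaimedTheorem := by
  have h6 : Step6C := step6C_of_step5C h5
  refine ⟨fun ν hν u₀ hu₀ hdiv hdec => ?_, fun ν hν u₀ hu₀ hdiv hper => ?_⟩
  · rcases h1 ν hν u₀ hu₀ hdiv hdec with ⟨u, p, hglob, h0, hE⟩ | ⟨T, hT, u, p, hsol, h0, hmax⟩
    · exact ⟨u, p, hglob.1.smooth_velocity, hglob.1.smooth_pressure,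
        ⟨fun t ht x => hglob.1.momentum t ht x, fun t ht => hglob.1.divFree t ht, h0⟩, hE⟩
    · exfalso
      obtain ⟨S, hS⟩ := h3 ν hν u₀ hu₀ hdiv hdec T hT u p hsol h0 hmax
      exact h6 ν hν T hT u p (Or.inl hsol) S hS
  · rcases h7 ν hν u₀ hu₀ hdiv hper with ⟨u, p, hsol, h0, hperiodic⟩ |
      ⟨T, hT, u, p, hsol, h0, hper', S, hS⟩
    · exact ⟨u, p, hsol.smooth_velocity, hsol.smooth_pressure,
        ⟨fun t ht x => hsol.momentum t ht x, fun t ht => hsol.divFree t ht, h0⟩, hperiodic⟩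
    · exfalso
      exact h6 ν hν T hT u p (Or.inr ⟨hsol, hper'⟩) S hS

/-- The same composition from the verdict-of-record step `Step8C` (through `step6C_of_step8C`).
[cite: Kyritsis2026, §4, pp. 95–97] -/
theorem claim_of_steps8C (h1 : Step_1) (h3 : Step_3) (h8 : Step8C) (h7 : Step_7) :
    ClaimedTheorem :=
  claim_of_stepsC h1 h3 (step5C_of_step6C (step6C_of_step8C h8)) h7

/-- **Step 2 HOLDS (kernel)**: Theorem 2.2 (2.12), the Beale–Kato–Majda criterion recalled by the
paper, is the tree's fact, discharged in `NSVorticityBKMHolds.lean`. Net Literature debt −1; no statement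
of this file is changed. [cite: Kyritsis2026, Theorem 2.2 eq. (2.12), pp. 90–91]
[cite: BealeKatoMajda1984, Theorem 1] -/
theorem step_2_holds : Step_2 :=
  lintegral_iSup_curl_eq_top_of_not_hasSobolevExtensionPast_holds

/-! ## Step 7 discharged: the periodic blow-up alternative with a blow-up point -/

open Literature.Analysis.FunctionSpaces in
/-- **Compactness of the fundamental cell: an unbounded periodic velocity on `[0,T)` has a blow-up
point.** If `u` is a classical solution on `[0,T) × ℝ³`, `ℤ³`-periodic in space, and
`sup_x ‖u(·,t)‖` is unbounded on `[0,T)`, then some `S ∈ ℝ³` is a velocity blow-up point at `T`: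
reduce the points of large velocity to the unit cell (periodicity), note that `u` is bounded on every
`[0,T−δ] ×` (closed cell) (continuity on a compact set), so the times accumulate at `T`, and take a
cluster point of the reduced points (Bolzano–Weierstrass). [folklore] -/
private theorem exists_velocityBlowupPoint {ν T : ℝ}
    {u : ℝ → EuclideanSpace ℝ (Fin 3) → EuclideanSpace ℝ (Fin 3)}
    {p : ℝ → EuclideanSpace ℝ (Fin 3) → ℝ}
    (hcl : IsClassicalNSSolutionOn (Ico 0 T) ν 0 u p)
    (hperT : ∀ t ∈ Ico 0 T, IsLatticePeriodic (u t) ∧ IsLatticePeriodic (p t))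
    (hblow : ∀ M : ℝ, ∃ t ∈ Ico 0 T, ∃ x : EuclideanSpace ℝ (Fin 3), M < ‖u t x‖) :
    ∃ S : EuclideanSpace ℝ (Fin 3), IsVelocityBlowupPoint u T S := by
  -- periodic reduction to the unit cell, which lies in the closed ball of radius `3`
  have hred : ∀ t ∈ Ico 0 T, ∀ x, u t (Torus.repr (Torus.proj x)) = u t x := fun t ht x =>
    Torus.IsLatticePeriodic.eq_of_proj_eq_holds (hperT t ht).1 (Torus.proj_repr (Torus.proj x))
  have hK : IsCompact (Metric.closedBall (0 : EuclideanSpace ℝ (Fin 3)) 3) := isCompact_closedBall _ _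
  have hreprK : ∀ x : EuclideanSpace ℝ (Fin 3),
      Torus.repr (Torus.proj x) ∈ Metric.closedBall (0 : EuclideanSpace ℝ (Fin 3)) 3 := by
    intro x
    rw [Metric.mem_closedBall, dist_zero_right]
    have h := Torus.norm_le_card_of_mem_unitCube (Torus.repr_mem_unitCube (Torus.proj x))
    simpa using h
  -- the sequences of times and reduced points with `‖u (t n) (y n)‖ > n`
  choose t ht x hx using fun n : ℕ => hblow n
  obtain ⟨y, hyK, hbig⟩ : ∃ y : ℕ → EuclideanSpace ℝ (Fin 3),
      (∀ n, y n ∈ Metric.closedBall (0 : EuclideanSpace ℝ (Fin 3)) 3) ∧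
        ∀ n : ℕ, (n : ℝ) < ‖u (t n) (y n)‖ :=
    ⟨fun n => Torus.repr (Torus.proj (x n)), fun n => hreprK (x n), fun n => by
      rw [hred _ (ht n)]; exact hx n⟩
  -- `u` is bounded on `[0, T-δ] × closedBall 0 3`, so the times accumulate at `T`
  have hcont : ContinuousOn (Function.uncurry u) (Ico 0 T ×ˢ univ) :=
    ContDiffOn.continuousOn hcl.smooth_velocity
  have hlate : ∀ δ : ℝ, 0 < δ → ∃ N : ℕ, ∀ n, N ≤ n → T - δ < t n := by
    intro δ hδ
    obtain ⟨B, hB⟩ := ((isCompact_Icc (a := (0 : ℝ)) (b := T - δ)).prod hK).exists_bound_of_continuousOn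
      (hcont.mono (prod_mono (Icc_subset_Ico_right (by linarith)) (subset_univ _)))
    refine ⟨⌈B⌉₊, fun n hn => ?_⟩
    by_contra hle
    push Not at hle
    have hmem : (t n, y n) ∈ Icc 0 (T - δ) ×ˢ Metric.closedBall (0 : EuclideanSpace ℝ (Fin 3)) 3 :=
      ⟨⟨(ht n).1, hle⟩, hyK n⟩
    have h1 : ‖u (t n) (y n)‖ ≤ B := by simpa only [Function.uncurry_apply_pair] using hB _ hmem
    have h2 : (B : ℝ) ≤ n := (Nat.le_ceil B).trans (by exact_mod_cast hn)
    exact absurd (hbig n) (not_lt.2 (h1.trans h2))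
  -- a cluster point of the reduced points is a blow-up point
  obtain ⟨S, -, φ, hφ, hlim⟩ := hK.tendsto_subseq hyK
  refine ⟨S, fun M r hr => ?_⟩
  obtain ⟨N, hN⟩ := hlate r hr
  have hev : ∀ᶠ k in atTop, dist ((y ∘ φ) k) S < r ∧ max N ⌈M⌉₊ ≤ k :=
    ((Metric.tendsto_nhds.1 hlim) r hr).and (eventually_ge_atTop _)
  obtain ⟨k, hk1, hk2⟩ := hev.exists
  have hkφ : k ≤ φ k := hφ.id_le k
  refine ⟨t (φ k), ht _, y (φ k), hk1, hN _ ((le_max_left _ _).trans (hk2.trans hkφ)), ?_⟩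
  calc M ≤ ⌈M⌉₊ := Nat.le_ceil M
    _ ≤ (k : ℝ) := by exact_mod_cast (le_max_right _ _).trans hk2
    _ ≤ (φ k : ℝ) := by exact_mod_cast hkφ
    _ < ‖u (t (φ k)) (y (φ k))‖ := hbig (φ k)

open Literature.Claims.NS.ClayVariants in
/-- **Step 7 holds** — the periodic package behind «(THEOREM B)» is a theorem of the tree: for
`ν > 0` and a smooth divergence-free `ℤ³`-periodic datum, either the printed periodic Clay problem (B)
at `f ≡ 0` is solvable — and then, renormalising the pressure (Tao's erratum, kernel theorem
`clayPeriodic_solvable_zero_iff_errata`), with `u` AND `p` periodic — or it is not, and then the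
tree's blow-up alternative `not_clayPeriodic_solvable_iff_exists_velocitySupBlowup` (torus local
theory + `L^∞`/BKM continuation, Literature) gives a periodic classical solution on some `[0,T*)`
with `sup_x ‖u‖` unbounded, which has a velocity blow-up point by compactness of the fundamental
cell (`exists_velocityBlowupPoint`). An in-file discharge of a named step typed «plausible»; no
statement of the file is modified. [cite: Kyritsis2026, Remarks 2.5–2.6 pp. 90–91, Lemma 3.2 p. 91 and §4 p. 97] [cite: FeffermanClay2006, (B) p. 2 and errata p. 6] -/
theorem step_7_holds : Step_7 := by
  intro ν hν u₀ hu₀ hdiv hper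
  by_cases hsol : clayPeriodic.Solvable ν 0 u₀
  · left
    obtain ⟨u, p, hu, hp, hns, hadm⟩ := (clayPeriodic_solvable_zero_iff_errata ν u₀).1 hsol
    obtain ⟨hcl, h0⟩ := isNavierStokesSolution_and_smooth_iff.1 ⟨hns, hu, hp⟩
    exact ⟨u, p, hcl, h0, hadm⟩
  · right
    obtain ⟨T, hT, u, p, hcl, hu0, hperT, hblow⟩ :=
      (not_clayPeriodic_solvable_iff_exists_velocitySupBlowup hν hu₀ hdiv hper).1 hsol
    exact ⟨T, hT, u, p, hcl, hu0, hperT, exists_velocityBlowupPoint hcl hperT hblow⟩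

/-! ## Step 1 discharged: Lemma 2.1 / Thm 2.1 (pp. 89–90), the whole-space local theory package, `ν > 0` -/

/-- Sobolev bounds of a finite-energy classical solution from an `H^∞` datum on every closed slab
`[0,T'']`, `T''` arbitrary (Tao's persistence of regularity for `T'' > 0`; for `T'' ≤ 0` restrict
from `[0, S]`). [folklore] -/
private theorem hasBoundedSobolevNormsOn_Icc_of_le {ν S : ℝ} (hν : 0 < ν) (hS : 0 < S)
    {u : ℝ → EuclideanSpace ℝ (Fin 3) → EuclideanSpace ℝ (Fin 3)} {p : ℝ → EuclideanSpace ℝ (Fin 3) → ℝ}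
    (hcl : IsClassicalNSSolutionOn (Icc 0 S) ν 0 u p) {A : ℝ≥0∞} (hA : A < ⊤)
    (hE : ∀ t ∈ Icc 0 S, ∫⁻ x, ‖u t x‖ₑ ^ 2 ≤ A)
    (h₀ : ∀ m : ℕ, ∫⁻ x, ‖iteratedFDeriv ℝ m (u 0) x‖ₑ ^ 2 < ⊤) {T'' : ℝ} (hT'' : T'' ≤ S) :
    HasBoundedSobolevNormsOn (Icc 0 T'') u :=
  (hcl.hasBoundedSobolevNormsOn_of_sobolevDatum_unforced hν hS
    ⟨A.toNNReal, fun t ht => (hE t ht).trans (ENNReal.coe_toNNReal hA.ne).ge⟩ h₀).mono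
    (Icc_subset_Icc_right hT'')

/-- **Step 1 HOLDS (kernel)** — Lemma 2.1 / Theorem 2.1 (pp. 89–90; Majda–Bertozzi Thm 3.4, Cor. 3.2),
the whole-space local theory package for `ν > 0` and a Clay datum (smooth, divergence free, rapidly
decaying): EITHER a global solution in the Beale–Kato–Majda class from `u₀` with bounded energy (2.7),
OR a class solution on some `[0,T*)`, `T* < ∞`, from `u₀` admitting no continuation in the class —
by the tree's finite-energy classical dichotomy (`finiteEnergy_classical_dichotomy`), horizon patching
with bounded energy (`IsClassicalNSSolutionOn.exists_Ici_of_forall_Icc_finiteEnergy`) and persistence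
of regularity (`hasBoundedSobolevNormsOn_of_sobolevDatum_unforced`); the proof is the first clause of
`Literature.Claims.NS.Kyritsis2021.step_1_holds` with the bounded-energy conjunct kept. An in-file
discharge of a step typed «plausible (known)»; no statement of the file is modified.
[cite: Kyritsis2026, Lemma 2.1 / Theorem 2.1, pp. 89–90]
[cite: MajdaBertozziCUP2002, Thm 3.4 p. 104, Cor 3.2 p. 112] -/
theorem step_1_holds : Step_1 := by
  intro ν hν u₀ hu₀ hdiv hdecay
  have hdiv' : VectorCalculus.IsDivFree u₀ := fun x => hdiv x
  have hH : ∀ n : ℕ, ∫⁻ x, ‖iteratedFDeriv ℝ n u₀ x‖ₑ ^ 2 < ⊤ := fun n =>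
    hdecay.lintegral_enorm_iteratedFDeriv_sq_lt_top n
  rcases finiteEnergy_classical_dichotomy hν hu₀ hdiv' hH with hall | hbad
  · -- global branch: patch the finite-horizon solutions, keep the bounded energy, read the class
    -- off Tao's persistence of regularity
    left
    have hH1 : MemLp (fderiv ℝ u₀) 2 volume := by
      have h1 : ∫⁻ x, ‖fderiv ℝ u₀ x‖ₑ ^ 2 < ⊤ := by
        refine lt_of_le_of_lt (le_of_eq (lintegral_congr fun x => ?_)) (hH 1)
        rw [← ofReal_norm, ← ofReal_norm, norm_iteratedFDeriv_one]
      exact ⟨(hu₀.continuous_fderiv (by simp)).aestronglyMeasurable,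
        eLpNorm_two_lt_top_of_lintegral_enorm_sq_lt_top h1⟩
    obtain ⟨u, p, hcl, hu0, hbdd, -⟩ :=
      IsClassicalNSSolutionOn.exists_Ici_of_forall_Icc_finiteEnergy hν hH1 hall
    obtain ⟨E, hEtop, hEb⟩ := hbdd
    have h₀ : ∀ m : ℕ, ∫⁻ x, ‖iteratedFDeriv ℝ m (u 0) x‖ₑ ^ 2 < ⊤ := by rw [hu0]; exact hH
    refine ⟨u, p, ⟨hcl, fun T'' => ?_⟩, hu0, ⟨E, hEtop, hEb⟩⟩
    have hS : 0 < max T'' 1 := lt_max_of_lt_right one_pos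
    exact hasBoundedSobolevNormsOn_Icc_of_le hν hS
      (hcl.mono Icc_subset_Ici_self (uniqueDiffOn_Icc hS)) hEtop (fun t ht => hEb t ht.1) h₀
      (le_max_left _ _)
  · -- blow-up branch: the maximal solution on `[0,T*)` has no continuation in the class
    right
    obtain ⟨Ts, hTs, u, p, hcl, hu0, ⟨A, hAtop, hE⟩, -, hno⟩ := hbad
    have h₀ : ∀ m : ℕ, ∫⁻ x, ‖iteratedFDeriv ℝ m (u 0) x‖ₑ ^ 2 < ⊤ := by rw [hu0]; exact hH
    have hsob : ∀ T' : ℝ, 0 < T' → T' < Ts → HasBoundedSobolevNormsOn (Icc 0 T') u :=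
      fun T' hT' hT'T =>
        hasBoundedSobolevNormsOn_Icc_of_le hν hT'
          (hcl.mono (Icc_subset_Ico_right hT'T) (uniqueDiffOn_Icc hT')) hAtop
          (fun t ht => hE t ⟨ht.1, ht.2.trans_lt hT'T⟩) h₀ le_rfl
    refine ⟨Ts, hTs, u, p, ⟨hcl, fun T'' hT'' => ?_⟩, hu0, ?_⟩
    · exact (hsob (max T'' (Ts / 2)) (lt_max_of_lt_right (half_pos hTs))
        (max_lt hT'' (half_lt_self hTs))).mono (Icc_subset_Icc_right (le_max_left _ _))
    · rintro ⟨T', hT'Ts, v, q, hv, hvB, hagree⟩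
      have hv0 : v 0 = u₀ := by rw [hagree 0 ⟨le_rfl, hTs⟩, hu0]
      obtain ⟨C₀, hC₀⟩ := hvB 0
      exact hno Ts le_rfl v q (hv.mono (Icc_subset_Ico_right hT'Ts) (uniqueDiffOn_Icc hTs)) hv0
        ⟨C₀, ENNReal.coe_lt_top, fun t ht => by
          rw [lintegral_enorm_sq_eq_lintegral_iteratedFDeriv_zero]; exact hC₀ t ht⟩


/-! ## Step 3 discharged: a finite maximal time produces a finite velocity blow-up point (Lemma 3.2 p. 91, pp. 96–97) -/

section Step3

open Metric Function
open scoped NNReal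

/-- A classical solution stays classical when the velocity is modified at times outside the time set
`S`. In-file copy of the tree lemma `IsClassicalNSSolutionOn.congr_velocity`. [folklore] -/
private theorem isClassicalNSSolutionOn_congr_velocity {S : Set ℝ} {ν : ℝ}
    {u v : ℝ → EuclideanSpace ℝ (Fin 3) → EuclideanSpace ℝ (Fin 3)}
    {p : ℝ → EuclideanSpace ℝ (Fin 3) → ℝ} (h : IsClassicalNSSolutionOn S ν 0 u p)
    (huv : ∀ t ∈ S, v t = u t) : IsClassicalNSSolutionOn S ν 0 v p where
  smooth_velocity :=
    h.smooth_velocity.congr fun z hz => by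
      change v z.1 z.2 = u z.1 z.2
      rw [huv z.1 (mem_prod.1 hz).1]
  smooth_pressure := h.smooth_pressure
  momentum t ht x := by
    have h1 : timeDerivWithin S v t x = timeDerivWithin S u t x := by
      simp only [timeDerivWithin]
      exact derivWithin_congr (fun s hs => by rw [huv s hs]) (by rw [huv t ht])
    rw [h1, huv t ht]
    exact h.momentum t ht x
  divFree t ht := by
    rw [huv t ht]
    exact h.divFree t ht

/-- A bounded velocity field on `[0,T) × ℝ³` with continuous slices has every component in
`L^∞_t L^∞_x` on `(0,T)`. [folklore] -/
private theorem memLqLp_top_top_component {T M : ℝ}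
    {u : ℝ → EuclideanSpace ℝ (Fin 3) → EuclideanSpace ℝ (Fin 3)}
    (hcont : ∀ t ∈ Ico 0 T, Continuous (u t)) (hM : ∀ t ∈ Ico 0 T, ∀ x, ‖u t x‖ ≤ M) (j : Fin 3) :
    MemLqLp ∞ ∞ (fun t x => u t x j) (Ioo 0 T) := by
  refine memLqLp_top_of_ae_slice_bound (C := ENNReal.ofReal M) ENNReal.ofReal_ne_top ?_
  refine (ae_restrict_iff' measurableSet_Ioo).2 (ae_of_all _ fun t ht => ?_)
  have htI : t ∈ Ico 0 T := ⟨ht.1.le, ht.2⟩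
  have hmeas : AEStronglyMeasurable (fun x => u t x j) volume :=
    (((EuclideanSpace.proj j : EuclideanSpace ℝ (Fin 3) →L[ℝ] ℝ).continuous).comp
      (hcont t htI)).aestronglyMeasurable
  have hbound : ∀ᵐ x ∂(volume : Measure (EuclideanSpace ℝ (Fin 3))), ‖u t x j‖ ≤ M :=
    ae_of_all _ fun x => (PiLp.norm_apply_le (u t x) j).trans (hM t htI x)
  refine ⟨memLp_top_of_bound hmeas M hbound, ?_⟩
  rw [eLpNorm_exponent_top]
  exact eLpNormEssSup_le_of_ae_bound hbound

/-- **Continuation when NO point of the final slice is a velocity blow-up point** (the contrapositive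
heart of Step 3): a class solution on `[0,T)`, `ν > 0`, with no velocity blow-up point at time `T`
continues in the class past `T` — no blow-up point ⇒ backward bounded at every `(T, x₀)` ⇒ (with the
Leray–Hopf structure on `[0,T]`, weak final slice) far-field + near-field bounds on `(T/4,T) × ℝ³`
(Seregin–Šverák 2002 assembly in the tree) and the class bound on `[0,T/2]` ⇒ `u ∈ L^∞_t L^∞_x(0,T)`
⇒ two-velocity-components criterion at the endpoint. [cite: Kyritsis2026, Lemma 3.2 p. 91 and pp. 96–97]
[cite: LemarieRieusset2016, proof of Thm. 14.5 (p. 512)] -/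
theorem hasSobolevExtensionPast_of_forall_not_isVelocityBlowupPoint {ν T : ℝ} (hν : 0 < ν) (hT : 0 < T)
    {u : ℝ → EuclideanSpace ℝ (Fin 3) → EuclideanSpace ℝ (Fin 3)}
    {p : ℝ → EuclideanSpace ℝ (Fin 3) → ℝ} (hsol : IsLocalClassSolution ν T u p)
    (hno : ∀ S : EuclideanSpace ℝ (Fin 3), ¬ IsVelocityBlowupPoint u T S) :
    HasSobolevExtensionPast ν u T := by
  -- Leray–Hopf on `[0,T]` after updating the final slice
  have hLH' : ∀ T' ∈ Ioo 0 T, IsLerayHopfOn T' ν 0 (u 0) u := fun T' hT' =>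
    Literature.Claims.NS.Kyritsis2021.isLerayHopfOn_of_isLocalClassSolution hν hsol hT'.1 hT'.2
  obtain ⟨Y, -, hLHv⟩ := exists_isLerayHopfOn_update_of_forall_lt hT hν hLH'
  set v : ℝ → EuclideanSpace ℝ (Fin 3) → EuclideanSpace ℝ (Fin 3) := Function.update u T Y with hv
  have hagree : ∀ t ∈ Ico 0 T, v t = u t := fun t ht => Function.update_of_ne (ne_of_lt ht.2) Y u
  have hv0 : v 0 = u 0 := hagree 0 ⟨le_rfl, hT⟩
  have hclv : IsClassicalNSSolutionOn (Ico 0 T) ν 0 v p :=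
    isClassicalNSSolutionOn_congr_velocity hsol.1 hagree
  have hLHv' : IsLerayHopfOn T ν 0 (v 0) v := by rw [hv0]; exact hLHv
  -- no blow-up point ⇒ backward bounded at every top point `(T, x₀)`
  have hloc : ∀ x₀ : EuclideanSpace ℝ (Fin 3), IsBackwardBoundedAt v T x₀ := by
    intro x₀
    have h := hno x₀
    unfold IsVelocityBlowupPoint at h
    push Not at h
    obtain ⟨M, r, hr, hM⟩ := h
    -- radius `r' = min r (min 1 T)`: then `r'² ≤ r' ≤ min r T`
    set r' : ℝ := min r (min 1 T) with hr'
    have hr'pos : 0 < r' := lt_min hr (lt_min one_pos hT)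
    have hr'r : r' ≤ r := min_le_left _ _
    have hr'1 : r' ≤ 1 := (min_le_right _ _).trans (min_le_left _ _)
    have hr'T : r' ≤ T := (min_le_right _ _).trans (min_le_right _ _)
    have hr'sq : r' ^ 2 ≤ r' := by nlinarith
    refine ⟨r', hr'pos, M, fun t ht x hx => ?_⟩
    have ht0 : 0 ≤ t := by linarith [ht.1]
    have htI : t ∈ Ico 0 T := ⟨ht0, ht.2⟩
    rw [hagree t htI]
    exact hM t htI x (lt_of_lt_of_le (mem_ball.1 hx) hr'r) (by linarith [ht.1])
  -- far field (Leray–Hopf tail) and near field (compactness) on `(T/4, T)`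
  have hδ : 0 < T / 4 := by positivity
  obtain ⟨R, M₁, hfar⟩ := SereginSverak2002.farField_bound hν hT hclv hLHv' hδ
  obtain ⟨M₂, hnear⟩ :=
    SereginSverak2002.nearField_bound hT (SereginSverak2002.continuousOn_uncurry hclv) hloc hδ R
  -- the class bound on `[0, T/2]`
  have hT2 : 0 < T / 2 := by positivity
  have hclhalf : IsClassicalNSSolutionOn (Icc 0 (T / 2)) ν 0 u p :=
    hsol.1.mono (Icc_subset_Ico_right (by linarith)) (uniqueDiffOn_Icc hT2)
  obtain ⟨B, -, hB⟩ := exists_forall_norm_le_of_hasBoundedSobolevNormsOn hclhalf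
    (hsol.2 (T / 2) (by linarith))
  -- a uniform bound on `[0,T) × ℝ³`
  have hbound : ∀ t ∈ Ico 0 T, ∀ x, ‖u t x‖ ≤ max B (max M₁ M₂) := by
    intro t ht x
    by_cases hth : t ≤ T / 2
    · exact (hB t ⟨ht.1, hth⟩ x).trans (le_max_left _ _)
    · have htq : T / 4 < t := by linarith [not_le.1 hth]
      rw [← hagree t ht]
      by_cases hx : R < ‖x‖
      · exact (hfar t ⟨htq, ht.2⟩ x hx).trans ((le_max_left _ _).trans (le_max_right _ _))
      · have h := hnear (t, x) ⟨⟨htq.le, ht.2.le⟩, mem_closedBall_zero_iff.2 (not_lt.1 hx)⟩ ht.2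
        exact h.trans ((le_max_right _ _).trans (le_max_right _ _))
  -- the `L^∞` endpoint criterion
  have hcont : ∀ t ∈ Ico 0 T, Continuous (u t) := fun t ht =>
    (hsol.1.contDiff_velocity ht).continuous
  exact baeChoe_two_velocity_components_criterion_top_of_le hν hT hsol.1 hsol.2 (α := ⊤) le_top 0
    fun j _ => memLqLp_top_top_component hcont hbound j

/-- **Step 3 HOLDS (kernel)** — the «Fefferman implicit hypothesis of velocities blow-up» with Lemma
3.2 (p. 91, pp. 96–97): for `ν > 0`, a class solution on `[0,T*)` that admits no continuation in the
class past the finite `T*` has a FINITE velocity blow-up point `S ∈ ℝ³` at `T*` (Galdi: no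
«singularity of the velocities at the spatial infinite»). Proof by contraposition
(`hasSobolevExtensionPast_of_forall_not_isVelocityBlowupPoint`): no blow-up point at `T*` ⇒ `u`
bounded on `[0,T*) × ℝ³` (the Leray–Hopf far field decays, the near field is compact) ⇒ continuation.
The Clay-datum hypotheses of the typed step are not used. An in-file discharge of a step typed
«plausible (known, non-trivial)»; no statement of the file is modified.
[cite: Kyritsis2026, Lemma 3.2 p. 91, pp. 96–97] [cite: LemarieRieusset2016, proof of Thm. 14.5 (p. 512)] -/
theorem step_3_holds : Step_3 := by
  intro ν hν _ _ _ _ T hT u p hsol _ hno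
  by_contra h
  push Not at h
  exact hno (hasSobolevExtensionPast_of_forall_not_isVelocityBlowupPoint hν hT hsol h)

end Step3

/-! ## Step 4 discharged: the velocity blow-up points at the maximal time are Lebesgue-null (Lemma 3.1 p. 91; Caffarelli–Kohn–Nirenberg's Theorem B at the top slice) -/

section Step4

open Metric Function TopologicalSpace
open scoped NNReal

/-- **The velocity blow-up points at the maximal time are `ℋ¹`-null in every ball of radius
`√(T/2)`** (class solution on `[0,T)`, `ν > 0`): Caffarelli–Kohn–Nirenberg's Theorem B at the top
of the backward cylinder `Q_ρ(T, c)`, `ρ = √(T/2)` — the tree theorem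
`tsai1998_top_singular_null_holds` (Tsai 1998, Lemma 4.2 and the following remark) — fed with the
Leray–Hopf structure on `[0,T]` of the final-slice update `v` of `u`
(`Kyritsis2021.isLerayHopfOn_of_isLocalClassSolution`, `exists_isLerayHopfOn_update_of_forall_lt`):
the gauged pair `(v, p − c)` is a suitable weak solution on the cylinder
(`SereginSverak2002.isSuitableWeakSolutionOn_gauge_of_classical`), with one energy bound
(`SereginSverak2002.eEnergy_le`), the Leray–Hopf weak gradient of finite dissipation
(`IsLerayHopfOn.exists_hasWeakSpatialGradientOn`) and `p − c ∈ L^{3/2}` of the slab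
(`SereginSverak2002.lintegral_slab_gauged_pressure_lt_top`); and a velocity blow-up point `S` of
`u` at `T` is a backward singular point of `v` at `(T, S)` (`u = v` is continuous below `T`,
`isBackwardSingularPoint_of_forall_exists_continuousAt`). [cite: Kyritsis2026, Lemma 3.1, p. 91]
[cite: CaffarelliKohnNirenberg1982, Theorem B (§6, p. 807)]
[cite: Tsai1998, Lemma 4.2 and the following remark (p. 46)] -/
theorem hausdorffMeasure_one_velocityBlowupPoints_inter_ball_eq_zero {ν T : ℝ} (hν : 0 < ν)
    (hT : 0 < T) {u : ℝ → EuclideanSpace ℝ (Fin 3) → EuclideanSpace ℝ (Fin 3)}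
    {p : ℝ → EuclideanSpace ℝ (Fin 3) → ℝ} (hsol : IsLocalClassSolution ν T u p)
    (c : EuclideanSpace ℝ (Fin 3)) :
    μH[1] ({S : EuclideanSpace ℝ (Fin 3) | IsVelocityBlowupPoint u T S} ∩
      ball c (Real.sqrt (T / 2))) = 0 := by
  -- Leray–Hopf on `[0,T]` after updating the final slice
  have hLH' : ∀ T' ∈ Ioo 0 T, IsLerayHopfOn T' ν 0 (u 0) u := fun T' hT' =>
    Literature.Claims.NS.Kyritsis2021.isLerayHopfOn_of_isLocalClassSolution hν hsol hT'.1 hT'.2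
  obtain ⟨Y, -, hLHv⟩ := exists_isLerayHopfOn_update_of_forall_lt hT hν hLH'
  set v : ℝ → EuclideanSpace ℝ (Fin 3) → EuclideanSpace ℝ (Fin 3) := Function.update u T Y with hv
  have hagree : ∀ t ∈ Ico 0 T, v t = u t := fun t ht => Function.update_of_ne (ne_of_lt ht.2) Y u
  have hv0 : v 0 = u 0 := hagree 0 ⟨le_rfl, hT⟩
  have hclv : IsClassicalNSSolutionOn (Ico 0 T) ν 0 v p :=
    isClassicalNSSolutionOn_congr_velocity hsol.1 hagree
  have hLHv' : IsLerayHopfOn T ν 0 (v 0) v := by rw [hv0]; exact hLHv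
  -- the cylinder `Q_ρ(T, c)`, `ρ = √(T/2)`, inside the open slab `(0,T) × ℝ³`
  set ρ : ℝ := Real.sqrt (T / 2) with hρ
  have hρ0 : 0 < ρ := Real.sqrt_pos.2 (by positivity)
  have hρsq : ρ ^ 2 = T / 2 := Real.sq_sqrt (by positivity)
  set Ω : Opens (ℝ × EuclideanSpace ℝ (Fin 3)) := parabolicCylinderOpens ρ (T, c) with hΩdef
  have hΩle : Ω ≤ slab (EuclideanSpace ℝ (Fin 3)) (Ioo 0 T) isOpen_Ioo := by
    intro z hz
    have hz' : z ∈ parabolicCylinder ρ (T, c) := hz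
    rw [mem_parabolicCylinder] at hz'
    exact mem_slab.2 ⟨by nlinarith [hz'.1.1], hz'.1.2⟩
  have hΩsub : (Ω : Set (ℝ × EuclideanSpace ℝ (Fin 3))) ⊆
      Ioo 0 T ×ˢ (univ : Set (EuclideanSpace ℝ (Fin 3))) := fun z hz =>
    ⟨mem_slab.1 (hΩle hz), mem_univ _⟩
  -- (1) the suitable weak solution `(v, p − c)` on the cylinder
  have hsw := SereginSverak2002.isSuitableWeakSolutionOn_gauge_of_classical hν hT hclv hLHv' Ω hΩsub
  -- (2) one energy bound
  have henergy : ∃ C : ℝ≥0, ∀ᵐ t : ℝ, t ∈ Ioo (T - ρ ^ 2) T →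
      ∫⁻ x in ball c ρ, ‖v t x‖ₑ ^ 2 ≤ C := by
    refine ⟨(ENNReal.ofReal (2 * VectorCalculus.kineticEnergy (v 0))).toNNReal,
      ae_of_all _ fun t ht => ?_⟩
    rw [ENNReal.coe_toNNReal ENNReal.ofReal_ne_top]
    have htc : t ∈ Icc 0 T := ⟨by nlinarith [ht.1], ht.2.le⟩
    exact (setLIntegral_le_lintegral _ _).trans (SereginSverak2002.eEnergy_le hν.le hLHv' htc)
  -- (3) the Leray–Hopf weak gradient, of finite dissipation
  obtain ⟨G, hG, -, hint, -⟩ := hLHv'.exists_hasWeakSpatialGradientOn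
  have hgrad : ∃ G : ℝ → EuclideanSpace ℝ (Fin 3) →
      EuclideanSpace ℝ (Fin 3) →L[ℝ] EuclideanSpace ℝ (Fin 3),
      HasWeakSpatialGradientOn (parabolicCylinderOpens ρ (T, c)) v G ∧
      ∫⁻ z in parabolicCylinder ρ (T, c),
        ENNReal.ofReal (frobeniusNormSq (G z.1 z.2)) < ⊤ :=
    ⟨G, hG.mono hΩle, (lintegral_mono_set hΩsub).trans_lt hint⟩
  -- (4) the gauged pressure in `L^{3/2}` of the cylinder
  have hp : ∫⁻ z in parabolicCylinder ρ (T, c),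
      ‖p z.1 z.2 - (p z.1 0 - normalisedPressure (v z.1) 0)‖ₑ ^ (3 / 2 : ℝ) < ⊤ :=
    (lintegral_mono_set hΩsub).trans_lt
      (SereginSverak2002.lintegral_slab_gauged_pressure_lt_top hν hT hclv hLHv')
  -- Tsai's theorem at the top of the cylinder
  have hnull := tsai1998_top_singular_null_holds hν hρ0 hsw henergy hgrad hp
  -- a velocity blow-up point of `u` at `T` is a backward singular point of `v` at `(T, S)`
  refine measure_mono_null (fun S hS => ?_) hnull
  refine ⟨hS.2, isBackwardSingularPoint_of_forall_exists_continuousAt fun r hr M => ?_⟩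
  set r' : ℝ := min r (min (r ^ 2) (T / 2)) with hr'
  have hr'pos : 0 < r' := lt_min hr (lt_min (by positivity) (by positivity))
  have hr'r : r' ≤ r := min_le_left _ _
  have hr'sq : r' ≤ r ^ 2 := (min_le_right _ _).trans (min_le_left _ _)
  have hr'T : r' ≤ T / 2 := (min_le_right _ _).trans (min_le_right _ _)
  obtain ⟨t, htI, x, hxS, hTt, hMx⟩ := hS.1 M r' hr'pos
  have ht0 : 0 < t := by linarith [htI.1]
  refine ⟨(t, x), ?_, ?_, ?_⟩
  · rw [mem_parabolicCylinder]
    exact ⟨⟨by linarith, htI.2⟩, lt_of_lt_of_le hxS hr'r⟩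
  · exact (SereginSverak2002.continuousOn_uncurry hclv).continuousAt
      (prod_mem_nhds (Ico_mem_nhds ht0 htI.2) univ_mem)
  · change M < ‖v t x‖
    rw [hagree t htI]
    exact hMx

/-- **The velocity blow-up points at the maximal time of a class solution form a Lebesgue-null
set** (`ν > 0`): `ℋ¹`-null in every ball of radius `√(T/2)`
(`hausdorffMeasure_one_velocityBlowupPoints_inter_ball_eq_zero`), hence `ℋ¹`-null (countable cover
by balls centred on a dense sequence), hence `ℋ³`-null (`Measure.hausdorffMeasure_mono`), hence
Lebesgue-null (`volume ≤ μH[3]` on `ℝ³`, the tree's `volume_le_hausdorffMeasure`).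
[cite: Kyritsis2026, Lemma 3.1, p. 91] [cite: CaffarelliKohnNirenberg1982, Theorem B (§6, p. 807)] -/
theorem volume_velocityBlowupPoints_eq_zero {ν T : ℝ} (hν : 0 < ν) (hT : 0 < T)
    {u : ℝ → EuclideanSpace ℝ (Fin 3) → EuclideanSpace ℝ (Fin 3)}
    {p : ℝ → EuclideanSpace ℝ (Fin 3) → ℝ} (hsol : IsLocalClassSolution ν T u p) :
    volume {S : EuclideanSpace ℝ (Fin 3) | IsVelocityBlowupPoint u T S} = 0 := by
  set S : Set (EuclideanSpace ℝ (Fin 3)) :=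
    {S : EuclideanSpace ℝ (Fin 3) | IsVelocityBlowupPoint u T S} with hS
  have hρ0 : 0 < Real.sqrt (T / 2) := Real.sqrt_pos.2 (by positivity)
  have h1 : μH[1] S = 0 := by
    have hSU : S ⊆ ⋃ n : ℕ,
        S ∩ ball (denseSeq (EuclideanSpace ℝ (Fin 3)) n) (Real.sqrt (T / 2)) := by
      intro x hx
      obtain ⟨n, hn⟩ :=
        (denseRange_denseSeq (EuclideanSpace ℝ (Fin 3))).exists_dist_lt x hρ0
      exact mem_iUnion.2 ⟨n, hx, mem_ball.2 hn⟩
    exact measure_mono_null hSU (measure_iUnion_null fun n =>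
      hausdorffMeasure_one_velocityBlowupPoints_inter_ball_eq_zero hν hT hsol _)
  have h3 : μH[((3 : ℕ) : ℝ)] S = 0 :=
    nonpos_iff_eq_zero.1 ((Measure.hausdorffMeasure_mono (by norm_num) S).trans h1.le)
  exact nonpos_iff_eq_zero.1
    ((Literature.MeasureTheory.Hausdorff.volume_le_hausdorffMeasure 3 S).trans h3.le)

/-- **Step 4 HOLDS (kernel)** — Lemma 3.1 (p. 91, «from the CKN theory») in its typed form: for
`ν > 0` and a class solution on `[0,T)`, the velocity blow-up points at `T` form a Lebesgue-null
set containing no open ball. Caffarelli–Kohn–Nirenberg's Theorem B at the top slice (Tsai 1998,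
Lemma 4.2 and remark; the tree theorem `tsai1998_top_singular_null_holds`) applied to the
Leray–Hopf structure of the class solution (`volume_velocityBlowupPoints_eq_zero`); a ball has
positive Lebesgue measure. An in-file discharge of a step typed «plausible (CKN 1982)»; no
statement of the file is modified. [cite: Kyritsis2026, Lemma 3.1, p. 91]
[cite: CaffarelliKohnNirenberg1982, Theorem B (§6, p. 807)]
[cite: Tsai1998, Lemma 4.2 and the following remark (p. 46)] -/
theorem step_4_holds : Step_4 := by
  intro ν hν T hT u p hsol
  have hnull := volume_velocityBlowupPoints_eq_zero hν hT hsol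
  exact ⟨hnull, fun x r hr hsub => (measure_ball_pos volume x hr).ne' (measure_mono_null hsub hnull)⟩

end Step4
end

end Literature.Claims.NS.Kyritsis2026
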